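import Literature.NumberTheory.ConnesConsani2021.QuasiInnerArchResidues
import Literature.NumberTheory.ConnesConsani2021.QuasiInnerProducts
import HarnessLib

/-!
# Connes–Consani 2021 (JNT) §4, Lemma 4.7 — the Gauss-multiplication factors `ρ_∞^{(m,k)}` are
# quasi-inner (PROVED: «the results of §2 continue to hold with minor changes»)

LINE 1 — LABEL: RH-FREE corpus literature (function theory of the factors
`ρ_∞^{(m,k)}(z) = (π/m)^{1/(2m) − z/m} Γ(z/(2m) + k/m)/Γ((1−z)/(2m) + k/m)` of `ρ_∞ = Γ_ℝ(z)/Γ_ℝ(1−z)`; no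
positivity statement, no statement about zeros of `ζ`); bears_on: W-C/W-P (sequel typing, no leaf role);
WHAT THIS IS NOT: any claim about RH — nothing in this file bears on the truth of RH.

Source: A. Connes, C. Consani, *Quasi-inner functions and local factors*, J. Number Theory **226** (2021)
139–167 = arXiv:2008.10974 [bib: `ConnesConsani2021QuasiInner`]; locators are arXiv tex chunks
`pNNNN:Lnn`.  Companion of `QuasiInnerLocalFactors.lean` / `QuasiInnerArchResidues.lean` (seat t17) and
`QuasiInnerSoninSpace.lean` / `QuasiInnerProducts.lean` (seat t18: `rhoFactor`, `gammaFactor`, `phiFactor`,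
the named fact `lemma_4_7_quasiInner`), same namespace `Literature.NumberTheory.ConnesConsani2021.QuasiInner`;
THEOREMS ONLY (no definition, no named fact).

## Content (RH-FREE)

Lemma 4.7 (p0014:L48–L56): «Each `ρ_∞^{(m,k)}` is a quasi inner function (relative to `ℂ₋`) … The proof
is the same as for `ρ_∞`, the poles are now the arithmetic progression `z = −2k − 2nm`, one applies
(4.6) [sic: the estimates of §2] … the results of §2 continue to hold with minor changes.»  We replay the
printed road of §2 (display «aminusk», Theorem 2.3, Theorem 2.1), as landed in `QuasiInnerArchResidues.lean`,
with period `2m` in place of `2`: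

* **An abstract Hankel lemma** (the mechanism of Thm 2.3/2.1, p0006:L59–L68 and p0005:L126–L136):
  `hasSum_hardyOffDiag_of_hasSum_fourierCoeff` / `isCompactOperator_hardyOffDiag_of_hasSum_fourierCoeff` —
  if the negative Fourier coefficients of a symbol `u ∈ L^∞(S¹)` are `û(−ℓ−1) = Σ_n c_n x_n^ℓ` with
  `Σ |c_n|/(1 − |x_n|) < ∞`, `|x_n| < 1`, then `(1 − 𝒫)u𝒫 = Σ_n c_n |ξ_{x_n}⟩⟨η_{x_n}|` (norm-convergent)
  and is compact (Lemma 2.2 = the landed `hardyOffDiag_szegoNeg`, `hardyOffDiag_eq_zero_of_fourierCoeff_neg_eq_zero`).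
* **The factors `ρ_∞^{(m,k)}`** (`rhoFactor m k`, `0 ≤ k < m`): simple poles at `−2k − 2mn` with residues
  `r_n` (`exists_rhoFactor_eq_div_sub_pole`, from `Γ(w)∏_{i≤n}(w+i) = Γ(w+n+1)`), `Σ|r_n| < ∞`; the Stirling
  bound on vertical strips (tree `GammaStirling.exists_norm_Gamma_vertical_le/ge`); the functional equation
  `ρ(z) = (π/m)² ρ(z+2m)/(w(z)(w'(z) − 1))`, `w = z/(2m)+k/m`, `w' = (1−z)/(2m)+k/m`, giving
  `|ρ| ≤ (16π²/3)^{min(J,4)}` on the lines `Re z = ½ − 2mJ`; the residue theorem on `[½ − 2mj, ½] × ℝ`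
  (tree `Literature.Analysis.Complex.integral_vertical_sub_eq_sum_of_simplePoles`) and `j → ∞`:
  the negative Fourier coefficients of `κ^{(m,k)} = ρ_∞^{(m,k)} ∘ ψ` on `S¹` are
  `Σ_n c_n x_n^ℓ`, `c_n = −8 r_n/(2p_n−3)²`, `x_n = ψ⁻¹(p_n)`, `p_n = −2k−2mn`.
* `lemma_4_7_quasiInner_holds : lemma_4_7_quasiInner` — **Lemma 4.7 (quasi-inner clause) PROVED**.

Nothing in this file bears on the truth of RH.
-/

noncomputable section

open _root_.MeasureTheory _root_.Complex AddCircle Filter Set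
open scoped Real ENNReal InnerProductSpace Topology ComplexConjugate Nat

namespace Literature.NumberTheory.ConnesConsani2021

namespace QuasiInner

/-! ### A. The factors `ρ_∞^{(m,k)}`: holomorphy, simple poles, residues -/

section Factors

/-- RH-FREE. `Γ(w) ∏_{i ≤ n} (w + i) = Γ(w + n + 1)` off the poles `w = −i`, `i ≤ n` (Mathlib's
`Complex.Gamma_add_one` iterated). [folklore] -/
private theorem gf_Gamma_mul_prod_range (n : ℕ) {w : ℂ} (hw : ∀ i : ℕ, i ≤ n → w + i ≠ 0) :
    Complex.Gamma w * ∏ i ∈ Finset.range (n + 1), (w + (i : ℂ)) = Complex.Gamma (w + ((n : ℂ) + 1)) := by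
  induction n with
  | zero =>
    have h0 : w ≠ 0 := by simpa using hw 0 le_rfl
    rw [Finset.prod_range_one]
    push_cast
    rw [add_zero, zero_add, Complex.Gamma_add_one w h0, mul_comm]
  | succ n ih =>
    have hw' : ∀ i : ℕ, i ≤ n → w + i ≠ 0 := fun i hi => hw i (hi.trans n.le_succ)
    have hwn : w + ((n : ℂ) + 1) ≠ 0 := by
      have := hw (n + 1) le_rfl
      push_cast at this
      exact this
    rw [Finset.prod_range_succ, ← mul_assoc, ih hw']
    push_cast
    rw [show w + ((n : ℂ) + 1 + 1) = (w + ((n : ℂ) + 1)) + 1 by ring, Complex.Gamma_add_one _ hwn]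
    ring

/-- RH-FREE. `∏_{i<n} (i − n) = (−1)^n n!`. [folklore] -/
private theorem gf_prod_range_neg_add (n : ℕ) :
    ∏ i ∈ Finset.range n, (-(n : ℂ) + (i : ℂ)) = (-1) ^ n * (n ! : ℂ) := by
  induction n with
  | zero => simp
  | succ n ih =>
    rw [Finset.prod_range_succ']
    push_cast
    have e : ∀ i : ℕ, (-((n : ℂ) + 1) + ((i : ℂ) + 1)) = (-(n : ℂ) + (i : ℂ)) := by
      intro i; ring
    simp_rw [e, ih]
    rw [Nat.factorial_succ]
    push_cast
    ring

/-- RH-FREE. `ρ_∞^{(m,k)}` unfolded: `(π/m)^{1/(2m) − z/m} Γ(z/(2m)+k/m)/Γ((1−z)/(2m)+k/m)` (eq. (4.7) with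
(4.5)). [cite: ConnesConsani2021QuasiInner, Lemma 4.7 eq. (4.7) (arXiv chunk p0014:L51)] -/
theorem rhoFactor_eq (m k : ℕ) (z : ℂ) :
    rhoFactor m k z = ((π : ℂ) / m) ^ (1 / (2 * (m : ℂ)) - z / m) *
      Complex.Gamma (z / (2 * (m : ℂ)) + (k : ℂ) / (m : ℂ)) *
        (Complex.Gamma ((1 - z) / (2 * (m : ℂ)) + (k : ℂ) / (m : ℂ)))⁻¹ := by
  rw [rhoFactor_def, phiFactor_def, gammaFactor_def, gammaFactor_def,
    div_eq_mul_inv (Complex.Gamma (z / (2 * (m : ℂ)) + (k : ℂ) / (m : ℂ))), mul_assoc]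

/-- RH-FREE. **`ρ_∞^{(m,k)}` is holomorphic off its poles** (the points where `γ_{m,k}` vanishes in Mathlib's
convention, i.e. `z = −2k − 2nm`; `1/Γ` is entire). [cite: ConnesConsani2021QuasiInner, Lemma 4.7 proof (arXiv chunk p0014:L56)] -/
theorem differentiableAt_rhoFactor {m : ℕ} (hm : 0 < m) (k : ℕ) {z : ℂ} (hz : gammaFactor m k z ≠ 0) :
    DifferentiableAt ℂ (rhoFactor m k) z := by
  have hm' : (m : ℂ) ≠ 0 := Nat.cast_ne_zero.mpr hm.ne'
  have hπ : (π : ℂ) ≠ 0 := ofReal_ne_zero.mpr Real.pi_pos.ne'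
  have heq : rhoFactor m k = fun z => ((π : ℂ) / m) ^ (1 / (2 * (m : ℂ)) - z / m) *
      Complex.Gamma (z / (2 * (m : ℂ)) + (k : ℂ) / (m : ℂ)) *
        (Complex.Gamma ((1 - z) / (2 * (m : ℂ)) + (k : ℂ) / (m : ℂ)))⁻¹ := funext (rhoFactor_eq m k)
  rw [heq]
  have hpoles : ∀ n : ℕ, z / (2 * (m : ℂ)) + (k : ℂ) / (m : ℂ) ≠ -n := by
    intro n h
    apply hz
    rw [gammaFactor_def, h, Complex.Gamma_neg_nat_eq_zero]
  have h1 : DifferentiableAt ℂ (fun z : ℂ => ((π : ℂ) / m) ^ (1 / (2 * (m : ℂ)) - z / m)) z :=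
    DifferentiableAt.const_cpow (by fun_prop) (Or.inl (div_ne_zero hπ hm'))
  have h2 : DifferentiableAt ℂ (fun z : ℂ => Complex.Gamma (z / (2 * (m : ℂ)) + (k : ℂ) / (m : ℂ))) z :=
    (Complex.differentiableAt_Gamma _ hpoles).comp z (by fun_prop)
  have h3 : DifferentiableAt ℂ (fun z : ℂ => (Complex.Gamma ((1 - z) / (2 * (m : ℂ)) + (k : ℂ) / (m : ℂ)))⁻¹) z :=
    (Complex.differentiable_one_div_Gamma.differentiableAt).comp z (by fun_prop)
  exact (h1.mul h2).mul h3

/-- RH-FREE. **The simple poles of `ρ_∞^{(m,k)}`**: «the poles are now the arithmetic progression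
`z = −2k − 2nm`», each simple, in the concrete form `ρ_∞^{(m,k)} = Φ/(z − p_n)` on `|z − p_n| < 1` with `Φ`
holomorphic there and `Φ(p_n) = r_n := 2m (π/m)^{1/(2m) − p_n/m} Γ((1−p_n)/(2m)+k/m)^{−1}/((−1)^n n!)`
(from `Γ(w)∏_{i≤n}(w+i) = Γ(w+n+1)`, `w(z) + n = (z − p_n)/(2m)`).
[cite: ConnesConsani2021QuasiInner, Lemma 4.7 proof (arXiv chunk p0014:L56) with §2 (p0005:L94–L104)] -/
theorem exists_rhoFactor_eq_div_sub_pole {m : ℕ} (hm : 0 < m) (k n : ℕ) :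
    ∃ Φ : ℂ → ℂ, DifferentiableOn ℂ Φ (Metric.ball (-(2 * (k : ℂ) + 2 * (m : ℂ) * (n : ℂ))) 1) ∧
      Φ (-(2 * (k : ℂ) + 2 * (m : ℂ) * (n : ℂ))) =
        2 * (m : ℂ) * ((π : ℂ) / m) ^ (1 / (2 * (m : ℂ)) - (-(2 * (k : ℂ) + 2 * (m : ℂ) * (n : ℂ))) / m) *
          (Complex.Gamma ((1 - (-(2 * (k : ℂ) + 2 * (m : ℂ) * (n : ℂ)))) / (2 * (m : ℂ)) + (k : ℂ) / (m : ℂ)))⁻¹ /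
            ((-1) ^ n * (n ! : ℂ)) ∧
      ∀ z ∈ Metric.ball (-(2 * (k : ℂ) + 2 * (m : ℂ) * (n : ℂ))) 1, z ≠ -(2 * (k : ℂ) + 2 * (m : ℂ) * (n : ℂ)) →
        rhoFactor m k z = Φ z / (z - -(2 * (k : ℂ) + 2 * (m : ℂ) * (n : ℂ))) := by
  have hm' : (m : ℂ) ≠ 0 := Nat.cast_ne_zero.mpr hm.ne'
  have hm0 : (0 : ℝ) < m := Nat.cast_pos.mpr hm
  have hπ : (π : ℂ) ≠ 0 := ofReal_ne_zero.mpr Real.pi_pos.ne'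
  set p : ℂ := -(2 * (k : ℂ) + 2 * (m : ℂ) * (n : ℂ)) with hp
  -- the affine argument `w(z) = z/(2m) + k/m`, `w(z) + n = (z − p)/(2m)`
  have hw : ∀ z : ℂ, z / (2 * (m : ℂ)) + (k : ℂ) / (m : ℂ) = -(n : ℂ) + (z - p) / (2 * (m : ℂ)) := by
    intro z; rw [hp]; field_simp; ring
  -- no other zero of `∏_{i<n}(w+i)`, and `w + n + 1` has positive real part, on the disc
  have hball : ∀ z ∈ Metric.ball p 1, ‖(z - p) / (2 * (m : ℂ))‖ < 1 / 2 := by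
    intro z hz
    rw [Metric.mem_ball, dist_eq_norm] at hz
    rw [norm_div, show ‖(2 * (m : ℂ))‖ = 2 * m by
      rw [show (2 * (m : ℂ)) = ((2 * m : ℝ) : ℂ) by push_cast; ring, Complex.norm_real, Real.norm_eq_abs,
        abs_of_pos (by positivity)]]
    rw [div_lt_iff₀ (by positivity)]
    have : (1 : ℝ) ≤ m := by exact_mod_cast hm
    nlinarith
  have hwi : ∀ z ∈ Metric.ball p 1, ∀ i : ℕ, i < n →
      -(n : ℂ) + (z - p) / (2 * (m : ℂ)) + (i : ℂ) ≠ 0 := by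
    intro z hz i hi h
    have h1 := hball z hz
    have h2 : (z - p) / (2 * (m : ℂ)) = (n : ℂ) - i := by linear_combination h
    rw [h2, show ((n : ℂ) - i) = (((n : ℝ) - i : ℝ) : ℂ) by push_cast; ring, Complex.norm_real,
      Real.norm_eq_abs] at h1
    have : (1 : ℝ) ≤ (n : ℝ) - i := by
      have : (i : ℝ) + 1 ≤ n := by exact_mod_cast hi
      linarith
    rw [abs_of_nonneg (by linarith)] at h1
    linarith
  have hprod : ∀ z ∈ Metric.ball p 1,
      ∏ i ∈ Finset.range n, (-(n : ℂ) + (z - p) / (2 * (m : ℂ)) + (i : ℂ)) ≠ 0 :=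
    fun z hz => Finset.prod_ne_zero_iff.2 fun i hi => hwi z hz i (Finset.mem_range.1 hi)
  have hre : ∀ z ∈ Metric.ball p 1, ∀ j : ℕ, -(n : ℂ) + (z - p) / (2 * (m : ℂ)) + ((n : ℂ) + 1) ≠ -j := by
    intro z hz j h
    have h1 := hball z hz
    have h2 : (z - p) / (2 * (m : ℂ)) = -(j : ℂ) - 1 := by linear_combination h
    rw [h2, show (-(j : ℂ) - 1) = ((-(j : ℝ) - 1 : ℝ) : ℂ) by push_cast; ring, Complex.norm_real,
      Real.norm_eq_abs] at h1
    have : |(-(j : ℝ) - 1)| = j + 1 := by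
      rw [abs_of_nonpos (by linarith [j.cast_nonneg (α := ℝ)])]; ring
    rw [this] at h1
    linarith [j.cast_nonneg (α := ℝ)]
  set Φ : ℂ → ℂ := fun z => ((π : ℂ) / m) ^ (1 / (2 * (m : ℂ)) - z / m) * (2 * (m : ℂ)) *
      Complex.Gamma (-(n : ℂ) + (z - p) / (2 * (m : ℂ)) + ((n : ℂ) + 1)) *
      (Complex.Gamma ((1 - z) / (2 * (m : ℂ)) + (k : ℂ) / (m : ℂ)))⁻¹ /
      ∏ i ∈ Finset.range n, (-(n : ℂ) + (z - p) / (2 * (m : ℂ)) + (i : ℂ)) with hΦ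
  refine ⟨Φ, ?_, ?_, ?_⟩
  · -- holomorphy on the disc
    intro z hz
    have h1 : DifferentiableAt ℂ (fun z : ℂ => ((π : ℂ) / m) ^ (1 / (2 * (m : ℂ)) - z / m)) z :=
      DifferentiableAt.const_cpow (by fun_prop) (Or.inl (div_ne_zero hπ hm'))
    have h2 : DifferentiableAt ℂ
        (fun z : ℂ => Complex.Gamma (-(n : ℂ) + (z - p) / (2 * (m : ℂ)) + ((n : ℂ) + 1))) z :=
      (Complex.differentiableAt_Gamma _ (hre z hz)).comp z (by fun_prop)
    have h3 : DifferentiableAt ℂ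
        (fun z : ℂ => (Complex.Gamma ((1 - z) / (2 * (m : ℂ)) + (k : ℂ) / (m : ℂ)))⁻¹) z :=
      (Complex.differentiable_one_div_Gamma.differentiableAt).comp z (by fun_prop)
    have h4 : DifferentiableAt ℂ
        (fun z : ℂ => ∏ i ∈ Finset.range n, (-(n : ℂ) + (z - p) / (2 * (m : ℂ)) + (i : ℂ))) z := by
      fun_prop
    exact ((((h1.mul (differentiableAt_const _)).mul h2).mul h3).div h4 (hprod z hz)).differentiableWithinAt
  · -- the residue
    simp only [hΦ]
    rw [sub_self, zero_div, add_zero, show (-(n : ℂ) + ((n : ℂ) + 1)) = 1 by ring, Complex.Gamma_one,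
      mul_one, gf_prod_range_neg_add]
    ring
  · -- the identity off the pole
    intro z hz hzp
    have hzp' : z - p ≠ 0 := sub_ne_zero.2 hzp
    have hwn : -(n : ℂ) + (z - p) / (2 * (m : ℂ)) + (n : ℂ) ≠ 0 := by
      rw [show -(n : ℂ) + (z - p) / (2 * (m : ℂ)) + (n : ℂ) = (z - p) / (2 * (m : ℂ)) by ring]
      exact div_ne_zero hzp' (mul_ne_zero two_ne_zero hm')
    have hall : ∀ i : ℕ, i ≤ n → -(n : ℂ) + (z - p) / (2 * (m : ℂ)) + (i : ℂ) ≠ 0 := by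
      intro i hi
      rcases hi.lt_or_eq with hi | rfl
      · exact hwi z hz i hi
      · exact hwn
    have key := gf_Gamma_mul_prod_range n hall
    rw [Finset.prod_range_succ] at key
    -- `Γ(w) = Γ(w+n+1)/(∏_{i<n}(w+i) · (w+n))`
    have hG : Complex.Gamma (-(n : ℂ) + (z - p) / (2 * (m : ℂ))) =
        Complex.Gamma (-(n : ℂ) + (z - p) / (2 * (m : ℂ)) + ((n : ℂ) + 1)) /
          ((∏ i ∈ Finset.range n, (-(n : ℂ) + (z - p) / (2 * (m : ℂ)) + (i : ℂ))) *
            (-(n : ℂ) + (z - p) / (2 * (m : ℂ)) + (n : ℂ))) := by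
      rw [eq_div_iff (mul_ne_zero (hprod z hz) hwn), key]
    rw [rhoFactor_eq, hw z, hG]
    simp only [hΦ]
    rw [show -(n : ℂ) + (z - p) / (2 * (m : ℂ)) + (n : ℂ) = (z - p) / (2 * (m : ℂ)) by ring]
    field_simp

/-- RH-FREE. **The residues decay factorially**: with `c = (1+4k)/(2m)`,
`|r_n| = 2m (π/m)^{2n+c}/(n! Γ(n+c)) ≤ 2m (π/m)^c ((π/m)²)^n/n!` for `n ≥ 2` («the series `α(n)` is summable
and tends to `0` extremely fast», p0005:L119, here for `ρ_∞^{(m,k)}`). [cite: ConnesConsani2021QuasiInner, §2 (arXiv chunk p0005:L115–L121) with Lemma 4.7 (p0014:L56)] -/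
theorem norm_rhoFactor_residue_le {m : ℕ} (hm : 0 < m) (k : ℕ) {n : ℕ} (hn : 2 ≤ n) :
    ‖2 * (m : ℂ) * ((π : ℂ) / m) ^ (1 / (2 * (m : ℂ)) - (-(2 * (k : ℂ) + 2 * (m : ℂ) * (n : ℂ))) / m) *
          (Complex.Gamma ((1 - (-(2 * (k : ℂ) + 2 * (m : ℂ) * (n : ℂ)))) / (2 * (m : ℂ)) + (k : ℂ) / (m : ℂ)))⁻¹ /
            ((-1) ^ n * (n ! : ℂ))‖ ≤
      2 * m * (π / m) ^ ((1 + 4 * k) / (2 * m) : ℝ) * ((π / m) ^ 2) ^ n / n ! := by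
  have hm' : (m : ℂ) ≠ 0 := Nat.cast_ne_zero.mpr hm.ne'
  have hm0 : (0 : ℝ) < m := Nat.cast_pos.mpr hm
  have hq : (0 : ℝ) < π / m := div_pos Real.pi_pos hm0
  set c : ℝ := (1 + 4 * k) / (2 * m) with hc
  -- the exponent and the Gamma argument are real
  have hexp : (1 / (2 * (m : ℂ)) - (-(2 * (k : ℂ) + 2 * (m : ℂ) * (n : ℂ))) / m) = ((2 * n + c : ℝ) : ℂ) := by
    rw [hc]; push_cast; field_simp; ring
  have harg : ((1 - (-(2 * (k : ℂ) + 2 * (m : ℂ) * (n : ℂ)))) / (2 * (m : ℂ)) + (k : ℂ) / (m : ℂ)) =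
      (((n : ℝ) + c : ℝ) : ℂ) := by
    rw [hc]; push_cast; field_simp; ring
  have hbase : ((π : ℂ) / m) = ((π / m : ℝ) : ℂ) := by push_cast; ring
  have hΓ1 : (1 : ℝ) ≤ Real.Gamma ((n : ℝ) + c) := by
    have hc0 : 0 < c := by rw [hc]; positivity
    have h2 : (2 : ℝ) ≤ (n : ℝ) + c := by
      have : (2 : ℝ) ≤ n := by exact_mod_cast hn
      linarith
    have hmono := Real.Gamma_strictMonoOn_Ici.monotoneOn (Set.self_mem_Ici) (Set.mem_Ici.mpr h2) h2
    rwa [Real.Gamma_two] at hmono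
  have hΓpos : 0 < Real.Gamma ((n : ℝ) + c) := by linarith
  rw [hexp, harg, hbase, Complex.Gamma_ofReal, ← Complex.ofReal_cpow hq.le]
  rw [norm_div, norm_mul, norm_mul, norm_mul, norm_inv, Complex.norm_real, Complex.norm_real, norm_mul,
    norm_pow, norm_neg, norm_one, one_pow, one_mul, Complex.norm_natCast, Complex.norm_ofNat,
    Complex.norm_natCast, Real.norm_eq_abs, Real.norm_eq_abs, abs_of_pos (Real.rpow_pos_of_pos hq _),
    abs_of_pos hΓpos]
  have hsplit : (π / m) ^ (2 * n + c : ℝ) = (π / m) ^ c * ((π / m) ^ 2) ^ n := by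
    rw [Real.rpow_add hq, show (2 * (n : ℝ) : ℝ) = ((2 * n : ℕ) : ℝ) by push_cast; ring, Real.rpow_natCast,
      pow_mul, mul_comm]
  rw [hsplit]
  have hfac : (0 : ℝ) < n ! := by positivity
  rw [div_le_div_iff₀ (by positivity) hfac]
  have hkey : 2 * (m : ℝ) * ((π / m) ^ c * ((π / m) ^ 2) ^ n) * (Real.Gamma ((n : ℝ) + c))⁻¹ ≤
      2 * (m : ℝ) * ((π / m) ^ c * ((π / m) ^ 2) ^ n) * 1 := by
    refine mul_le_mul_of_nonneg_left (inv_le_one_of_one_le₀ hΓ1) (by positivity)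
  nlinarith [hkey, hfac]

end Factors

/-! ### B. Bounds for `ρ_∞^{(m,k)}`: Stirling on strips, the functional equation on the lines `Re z = ½ − 2mJ` -/

section FactorBounds

/-- RH-FREE. **`ρ_∞^{(m,k)}` is bounded on `{A ≤ Re z ≤ ½, |Im z| ≥ 2m}`** (the tree's uniform vertical
Stirling formula `GammaStirling.exists_norm_Gamma_vertical_le/ge` applied to `Γ(z/(2m)+k/m)` and
`Γ((1−z)/(2m)+k/m)`: the ratio is `≍ |t/(2m)|^{(2σ−1)/(2m)} ≤ 1`; the factor `(π/m)^{1/(2m)−z/m}` has modulus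
`(π/m)^{1/(2m)−σ/m} ≤ π^{1/(2m)−A/m}`). [cite: ConnesConsani2021QuasiInner, Lemma 4.7 proof «the results of §2 continue to hold» (arXiv chunk p0014:L56) with §2 (p0005:L62–L66)] -/
theorem exists_norm_rhoFactor_le_of_le_abs_im {m : ℕ} (hm : 0 < m) (k : ℕ) (A : ℝ) :
    ∃ K : ℝ, 0 < K ∧ ∀ σ ∈ Icc A (1 / 2), ∀ t : ℝ, 2 * (m : ℝ) ≤ |t| →
      ‖rhoFactor m k ((σ : ℂ) + t * I)‖ ≤ K := by
  have hm0 : (0 : ℝ) < m := Nat.cast_pos.mpr hm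
  have hm' : (m : ℂ) ≠ 0 := Nat.cast_ne_zero.mpr hm.ne'
  obtain ⟨C₁, hC₁, h₁⟩ := Literature.Analysis.SpecialFunctions.GammaStirling.exists_norm_Gamma_vertical_le
    (A / (2 * m) + k / m) (1 / (4 * m) + k / m)
  obtain ⟨c₂, hc₂, h₂⟩ := Literature.Analysis.SpecialFunctions.GammaStirling.exists_norm_Gamma_vertical_ge
    (1 / (4 * m) + k / m) ((1 - A) / (2 * m) + k / m)
  have hπ := Real.pi_pos
  have hπ1 : (1 : ℝ) ≤ π := by linarith [Real.two_le_pi]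
  have hq : (0 : ℝ) < π / m := div_pos hπ hm0
  refine ⟨π ^ (1 / (2 * (m : ℝ)) - A / m) * (C₁ / c₂), by positivity, fun σ hσ t ht => ?_⟩
  set z : ℂ := (σ : ℂ) + t * I with hzD
  have hu : 1 ≤ |t / (2 * m)| := by
    rw [abs_div, abs_of_pos (by positivity : (0:ℝ) < 2 * m), le_div_iff₀ (by positivity), one_mul]; exact ht
  have hu' : 1 ≤ |-(t / (2 * m))| := by rwa [abs_neg]
  have ht0 : 0 < |t / (2 * m)| := by linarith
  have hx1 : σ / (2 * m) + k / m ∈ Icc (A / (2 * m) + k / m) (1 / (4 * m) + k / m) := by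
    constructor
    · have := div_le_div_of_nonneg_right (c := 2 * (m : ℝ)) hσ.1 (by positivity); linarith
    · have := div_le_div_of_nonneg_right (c := 2 * (m : ℝ)) hσ.2 (by positivity)
      rw [show (1 / 2 : ℝ) / (2 * m) = 1 / (4 * m) by field_simp; ring] at this; linarith
  have hx2 : (1 - σ) / (2 * m) + k / m ∈ Icc (1 / (4 * (m : ℝ)) + k / m) ((1 - A) / (2 * m) + k / m) := by
    constructor
    · have := div_le_div_of_nonneg_right (c := 2 * (m : ℝ)) (by linarith [hσ.2] : (1 / 2 : ℝ) ≤ 1 - σ)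
        (by positivity)
      rw [show (1 / 2 : ℝ) / (2 * m) = 1 / (4 * m) by field_simp; ring] at this; linarith
    · have := div_le_div_of_nonneg_right (c := 2 * (m : ℝ)) (by linarith [hσ.1] : 1 - σ ≤ 1 - A)
        (by positivity); linarith
  have hup := h₁ (σ / (2 * m) + k / m) hx1 (t / (2 * m)) hu
  have hlo := h₂ ((1 - σ) / (2 * m) + k / m) hx2 (-(t / (2 * m))) hu'
  rw [abs_neg] at hlo
  have e1 : z / (2 * (m : ℂ)) + (k : ℂ) / (m : ℂ) =
      (((σ / (2 * m) + k / m : ℝ)) : ℂ) + (((t / (2 * m) : ℝ)) : ℂ) * I := by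
    rw [hzD]; push_cast; field_simp; ring
  have e2 : (1 - z) / (2 * (m : ℂ)) + (k : ℂ) / (m : ℂ) =
      ((((1 - σ) / (2 * m) + k / m : ℝ)) : ℂ) + (((-(t / (2 * m)) : ℝ)) : ℂ) * I := by
    rw [hzD]; push_cast; field_simp; ring
  have hbase : ((π : ℂ) / m) = ((π / m : ℝ) : ℂ) := by push_cast; ring
  have ere : (1 / (2 * (m : ℂ)) - z / m).re = 1 / (2 * m) - σ / m := by
    rw [hzD]
    have : (1 / (2 * (m : ℂ)) - ((σ : ℂ) + t * I) / m) = (((1 / (2 * m) - σ / m : ℝ)) : ℂ) + (((-(t / m)) : ℝ) : ℂ) * I := by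
      push_cast; field_simp; ring
    rw [this, Complex.add_re, Complex.ofReal_re, Complex.re_ofReal_mul, Complex.I_re, mul_zero, add_zero]
  set E : ℝ := Real.exp (-(π * |t / (2 * m)|) / 2) with hE
  set a₁ : ℝ := |t / (2 * m)| ^ (σ / (2 * m) + k / m - 1 / 2) with ha₁
  set a₂ : ℝ := |t / (2 * m)| ^ ((1 - σ) / (2 * m) + k / m - 1 / 2) with ha₂
  have ha₁0 : 0 < a₁ := Real.rpow_pos_of_pos ht0 _
  have ha₂0 : 0 < a₂ := Real.rpow_pos_of_pos ht0 _
  have hE0 : E ≠ 0 := (Real.exp_pos _).ne'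
  have hG2 : 0 < ‖Complex.Gamma ((1 - z) / (2 * (m : ℂ)) + (k : ℂ) / (m : ℂ))‖ := by
    rw [e2]; exact lt_of_lt_of_le (by positivity) hlo
  -- the Gamma ratio
  have hratio : ‖Complex.Gamma (z / (2 * (m : ℂ)) + (k : ℂ) / (m : ℂ))‖ *
      ‖(Complex.Gamma ((1 - z) / (2 * (m : ℂ)) + (k : ℂ) / (m : ℂ)))⁻¹‖ ≤ C₁ / c₂ := by
    rw [norm_inv, ← div_eq_mul_inv, e1, e2]
    rw [e2] at hG2
    calc ‖Complex.Gamma ((((σ / (2 * m) + k / m : ℝ)) : ℂ) + (((t / (2 * m) : ℝ)) : ℂ) * I)‖ /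
          ‖Complex.Gamma (((((1 - σ) / (2 * m) + k / m : ℝ)) : ℂ) + (((-(t / (2 * m)) : ℝ)) : ℂ) * I)‖
        ≤ (C₁ * a₁ * E) / (c₂ * a₂ * E) := div_le_div₀ (by positivity) hup (by positivity) hlo
      _ = C₁ / c₂ * (a₁ / a₂) := by field_simp
      _ = C₁ / c₂ * |t / (2 * m)| ^ ((2 * σ - 1) / (2 * m)) := by
          rw [ha₁, ha₂, ← Real.rpow_sub ht0]; congr 2; ring
      _ ≤ C₁ / c₂ * 1 := by
          refine mul_le_mul_of_nonneg_left ?_ (by positivity)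
          refine Real.rpow_le_one_of_one_le_of_nonpos hu ?_
          exact div_nonpos_of_nonpos_of_nonneg (by linarith [hσ.2]) (by positivity)
      _ = C₁ / c₂ := mul_one _
  -- the power of `π/m`
  have hexp0 : 0 ≤ 1 / (2 * (m : ℝ)) - σ / m := by
    rw [show 1 / (2 * (m : ℝ)) - σ / m = (1 / 2 - σ) / m by field_simp]
    exact div_nonneg (by linarith [hσ.2]) hm0.le
  have hpow : ‖((π : ℂ) / m) ^ (1 / (2 * (m : ℂ)) - z / m)‖ ≤ π ^ (1 / (2 * (m : ℝ)) - A / m) := by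
    rw [hbase, Complex.norm_cpow_eq_rpow_re_of_pos hq, ere]
    calc (π / m) ^ (1 / (2 * (m : ℝ)) - σ / m) ≤ π ^ (1 / (2 * (m : ℝ)) - σ / m) :=
          Real.rpow_le_rpow hq.le (div_le_self hπ.le (by exact_mod_cast hm)) hexp0
      _ ≤ π ^ (1 / (2 * (m : ℝ)) - A / m) := by
          refine Real.rpow_le_rpow_of_exponent_le hπ1 ?_
          have := div_le_div_of_nonneg_right (c := (m : ℝ)) hσ.1 hm0.le
          linarith
  rw [rhoFactor_eq, norm_mul, norm_mul, mul_assoc]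
  exact mul_le_mul hpow hratio (by positivity) (by positivity)

/-- RH-FREE. **The functional equation of `ρ_∞^{(m,k)}` under `z ↦ z + 2m`** (the analogue of «archimfact1»):
`ρ(z) = ρ(z+2m) · (π/m)² / (w(z)(w'(z) − 1))`, `w = z/(2m)+k/m`, `w' = (1−z)/(2m)+k/m` (from
`Γ(w+1) = wΓ(w)`). [cite: ConnesConsani2021QuasiInner, §2 «archimfact1» (arXiv chunk p0005:L13) with Lemma 4.7 (p0014:L56)] -/
theorem rhoFactor_eq_shift_mul {m : ℕ} (hm : 0 < m) (k : ℕ) {z : ℂ}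
    (hw : z / (2 * (m : ℂ)) + (k : ℂ) / (m : ℂ) ≠ 0)
    (hw' : (1 - z) / (2 * (m : ℂ)) + (k : ℂ) / (m : ℂ) - 1 ≠ 0) :
    rhoFactor m k z = rhoFactor m k (z + 2 * m) *
      (((π : ℂ) / m) ^ 2 / ((z / (2 * (m : ℂ)) + (k : ℂ) / (m : ℂ)) *
        ((1 - z) / (2 * (m : ℂ)) + (k : ℂ) / (m : ℂ) - 1))) := by
  have hm' : (m : ℂ) ≠ 0 := Nat.cast_ne_zero.mpr hm.ne'
  have hπ : (π : ℂ) ≠ 0 := ofReal_ne_zero.mpr Real.pi_pos.ne'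
  have hb : ((π : ℂ) / m) ≠ 0 := div_ne_zero hπ hm'
  set w : ℂ := z / (2 * (m : ℂ)) + (k : ℂ) / (m : ℂ) with hwA
  set w' : ℂ := (1 - z) / (2 * (m : ℂ)) + (k : ℂ) / (m : ℂ) with hwB
  have e1 : (z + 2 * m) / (2 * (m : ℂ)) + (k : ℂ) / (m : ℂ) = w + 1 := by
    rw [hwA]; field_simp; ring
  have e2 : (1 - (z + 2 * m)) / (2 * (m : ℂ)) + (k : ℂ) / (m : ℂ) = w' - 1 := by
    rw [hwB]; field_simp; ring
  have e3 : ((π : ℂ) / m) ^ (1 / (2 * (m : ℂ)) - (z + 2 * m) / m) =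
      ((π : ℂ) / m) ^ (1 / (2 * (m : ℂ)) - z / m) / ((π : ℂ) / m) ^ 2 := by
    rw [show (1 / (2 * (m : ℂ)) - (z + 2 * m) / m) = (1 / (2 * (m : ℂ)) - z / m) - 2 by field_simp; ring,
      Complex.cpow_sub _ _ hb, Complex.cpow_two]
  have hG1 : Complex.Gamma (w + 1) = w * Complex.Gamma w := Complex.Gamma_add_one w hw
  have hG2 : (Complex.Gamma (w' - 1))⁻¹ = (w' - 1) * (Complex.Gamma w')⁻¹ := by
    have h := Complex.Gamma_add_one (w' - 1) hw'
    rw [sub_add_cancel] at h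
    rw [h, mul_inv, ← mul_assoc, mul_inv_cancel₀ hw', one_mul]
  rw [rhoFactor_eq, rhoFactor_eq, e1, e2, e3, ← hwA, ← hwB, hG1, hG2]
  have hp2 : ((π : ℂ) / m) ^ 2 ≠ 0 := pow_ne_zero 2 hb
  field_simp

/-- RH-FREE. **On the lines `Re z = ½ − 2mJ`: `|ρ_∞^{(m,k)}(z)| ≤ (16π²/3)^{min(J,4)}`** (`0 ≤ k < m`) — from
`|ρ_∞^{(m,k)}| = 1` on `∂ℂ₋` (`lemma_4_7_norm`) and the functional equation: each step to the left costs the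
factor `(π/m)²/(|w||w'−1|) ≤ (π/m)²/((J+3/(4m))(J+1/(4m)))`, which is `≤ 16π²/3` always and `≤ 1` from
`J = 4` on (the print's `ε(m) → 0` on the left side `V`, in uniformly bounded form).
[cite: ConnesConsani2021QuasiInner, §2 (arXiv chunk p0005:L72–L84) with Lemma 4.7 (p0014:L56)] -/
theorem norm_rhoFactor_leftLine_le {m : ℕ} (hm : 0 < m) {k : ℕ} (hk : k < m) (J : ℕ) (t : ℝ) :
    ‖rhoFactor m k ((((1 / 2 - 2 * m * J : ℝ)) : ℂ) + t * I)‖ ≤ (16 * π ^ 2 / 3) ^ min J 4 := by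
  have hm0 : (0 : ℝ) < m := Nat.cast_pos.mpr hm
  have hm' : (m : ℂ) ≠ 0 := Nat.cast_ne_zero.mpr hm.ne'
  have hkm : (k : ℝ) / m ≤ 1 - 1 / m := by
    rw [div_le_iff₀ hm0, sub_mul, one_mul, div_mul_cancel₀ _ hm0.ne']
    have : (k : ℝ) + 1 ≤ m := by exact_mod_cast hk
    linarith
  have hk0 : (0 : ℝ) ≤ (k : ℝ) / m := by positivity
  induction J with
  | zero =>
    simp only [CharP.cast_eq_zero, mul_zero, sub_zero, Nat.zero_min, pow_zero]
    rw [show ((((1 / 2 : ℝ)) : ℂ)) = 1 / 2 by push_cast; ring]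
    exact (lemma_4_7_norm hm k t).le
  | succ J ih =>
    have hπ := Real.pi_pos
    set z : ℂ := ((((1 / 2 - 2 * m * (J + 1 : ℕ) : ℝ)) : ℂ)) + t * I with hzD
    have hz2 : z + 2 * m = ((((1 / 2 - 2 * m * J : ℝ)) : ℂ)) + t * I := by
      rw [hzD]; push_cast; ring
    -- real parts of `w` and `w' − 1`
    have hwre : (z / (2 * (m : ℂ)) + (k : ℂ) / (m : ℂ)).re = 1 / (4 * m) - (J + 1) + k / m := by
      rw [hzD]
      have : ((((1 / 2 - 2 * m * (J + 1 : ℕ) : ℝ)) : ℂ) + t * I) / (2 * (m : ℂ)) + (k : ℂ) / (m : ℂ) =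
          ((((1 / (4 * m) - (J + 1) + k / m : ℝ)) : ℂ)) + (((t / (2 * m) : ℝ)) : ℂ) * I := by
        push_cast; field_simp; ring
      rw [this, Complex.add_re, Complex.ofReal_re, Complex.re_ofReal_mul, Complex.I_re, mul_zero, add_zero]
    have hw're : ((1 - z) / (2 * (m : ℂ)) + (k : ℂ) / (m : ℂ) - 1).re = J + 1 / (4 * m) + k / m := by
      rw [hzD]
      have : (1 - ((((1 / 2 - 2 * m * (J + 1 : ℕ) : ℝ)) : ℂ) + t * I)) / (2 * (m : ℂ)) + (k : ℂ) / (m : ℂ) - 1 =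
          ((((J + 1 / (4 * m) + k / m : ℝ)) : ℂ)) + (((-(t / (2 * m)) : ℝ)) : ℂ) * I := by
        push_cast; field_simp; ring
      rw [this, Complex.add_re, Complex.ofReal_re, Complex.re_ofReal_mul, Complex.I_re, mul_zero, add_zero]
    have hwpos : (J : ℝ) + 3 / (4 * m) ≤ -(z / (2 * (m : ℂ)) + (k : ℂ) / (m : ℂ)).re := by
      rw [hwre]
      have : 3 / (4 * (m : ℝ)) = 1 / m - 1 / (4 * m) := by field_simp; ring
      linarith
    have hw'pos : (J : ℝ) + 1 / (4 * m) ≤ ((1 - z) / (2 * (m : ℂ)) + (k : ℂ) / (m : ℂ) - 1).re := by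
      rw [hw're]; linarith
    have h34 : (0 : ℝ) < (J : ℝ) + 3 / (4 * m) := by positivity
    have h14 : (0 : ℝ) < (J : ℝ) + 1 / (4 * m) := by positivity
    have hw0 : z / (2 * (m : ℂ)) + (k : ℂ) / (m : ℂ) ≠ 0 := fun h => by
      have := congrArg Complex.re h
      rw [Complex.zero_re] at this
      linarith
    have hw'0 : (1 - z) / (2 * (m : ℂ)) + (k : ℂ) / (m : ℂ) - 1 ≠ 0 := fun h => by
      have := congrArg Complex.re h
      rw [Complex.zero_re] at this
      linarith
    have hnw : (J : ℝ) + 3 / (4 * m) ≤ ‖z / (2 * (m : ℂ)) + (k : ℂ) / (m : ℂ)‖ := by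
      refine hwpos.trans ?_
      exact (neg_le_abs _).trans (abs_re_le_norm _)
    have hnw' : (J : ℝ) + 1 / (4 * m) ≤ ‖(1 - z) / (2 * (m : ℂ)) + (k : ℂ) / (m : ℂ) - 1‖ :=
      hw'pos.trans ((le_abs_self _).trans (abs_re_le_norm _))
    -- the functional equation, in norm
    have hfe := rhoFactor_eq_shift_mul hm k hw0 hw'0
    have hnorm : ‖rhoFactor m k z‖ = ‖rhoFactor m k (z + 2 * m)‖ *
        ((π / m) ^ 2 / (‖z / (2 * (m : ℂ)) + (k : ℂ) / (m : ℂ)‖ *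
          ‖(1 - z) / (2 * (m : ℂ)) + (k : ℂ) / (m : ℂ) - 1‖)) := by
      rw [hfe, norm_mul, norm_div, norm_mul, norm_pow,
        show ((π : ℂ) / m) = ((π / m : ℝ) : ℂ) by push_cast; ring, Complex.norm_real, Real.norm_eq_abs,
        abs_of_pos (div_pos hπ hm0)]
    have hD : ((J : ℝ) + 3 / (4 * m)) * ((J : ℝ) + 1 / (4 * m)) ≤
        ‖z / (2 * (m : ℂ)) + (k : ℂ) / (m : ℂ)‖ * ‖(1 - z) / (2 * (m : ℂ)) + (k : ℂ) / (m : ℂ) - 1‖ :=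
      mul_le_mul hnw hnw' h14.le (norm_nonneg _)
    have hD0 : (0 : ℝ) < ((J : ℝ) + 3 / (4 * m)) * ((J : ℝ) + 1 / (4 * m)) := by positivity
    have hstep : ‖rhoFactor m k z‖ ≤ (16 * π ^ 2 / 3) ^ min J 4 *
        ((π / m) ^ 2 / (((J : ℝ) + 3 / (4 * m)) * ((J : ℝ) + 1 / (4 * m)))) := by
      rw [hnorm, hz2]
      exact mul_le_mul ih (div_le_div_of_nonneg_left (by positivity) hD0 hD) (by positivity) (by positivity)
    refine hstep.trans ?_
    have hπm : (π / m) ^ 2 ≤ π ^ 2 := by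
      refine pow_le_pow_left₀ (by positivity) (div_le_self hπ.le (by exact_mod_cast hm)) 2
    rcases Nat.lt_or_ge J 4 with hJ | hJ
    · -- one more (possibly large) factor: `(π/m)²/((J+3/(4m))(J+1/(4m))) ≤ (π/m)²·16m²/3 = 16π²/3`
      rw [min_eq_left hJ.le, min_eq_left (by omega : J + 1 ≤ 4), pow_succ]
      refine mul_le_mul_of_nonneg_left ?_ (by positivity)
      rw [div_le_iff₀ hD0]
      have hlow : 3 / (16 * (m : ℝ) ^ 2) ≤ ((J : ℝ) + 3 / (4 * m)) * ((J : ℝ) + 1 / (4 * m)) := by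
        have : 3 / (16 * (m : ℝ) ^ 2) = (3 / (4 * m)) * (1 / (4 * m)) := by field_simp; ring
        rw [this]
        exact mul_le_mul (by linarith [J.cast_nonneg (α := ℝ)]) (by linarith [J.cast_nonneg (α := ℝ)])
          (by positivity) h34.le
      calc (π / m) ^ 2 = 16 * π ^ 2 / 3 * (3 / (16 * (m : ℝ) ^ 2)) := by field_simp
        _ ≤ 16 * π ^ 2 / 3 * (((J : ℝ) + 3 / (4 * m)) * ((J : ℝ) + 1 / (4 * m))) :=
            mul_le_mul_of_nonneg_left hlow (by positivity)
    · -- the factor is `≤ 1` from `J = 4` on (`(π/m)² ≤ π² < 16 ≤ J²`)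
      rw [min_eq_right hJ, min_eq_right (by omega : 4 ≤ J + 1)]
      refine mul_le_of_le_one_right (by positivity) ?_
      rw [div_le_one hD0]
      have h4 : (4 : ℝ) ≤ J := by exact_mod_cast hJ
      have hπ4 := Real.pi_lt_four
      have h3m : (0 : ℝ) < 3 / (4 * m) := by positivity
      have h1m : (0 : ℝ) < 1 / (4 * m) := by positivity
      have ha : (4 : ℝ) ≤ (J : ℝ) + 3 / (4 * m) := by linarith
      have hb : (4 : ℝ) ≤ (J : ℝ) + 1 / (4 * m) := by linarith
      have hJJ : (16 : ℝ) ≤ ((J : ℝ) + 3 / (4 * m)) * ((J : ℝ) + 1 / (4 * m)) := by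
        have := mul_le_mul ha hb (by norm_num) (by linarith)
        linarith
      have hπ2 : π ^ 2 < 16 := by nlinarith [Real.pi_pos]
      linarith

end FactorBounds

/-! ### C. The residue theorem on `[½ − 2mj, ½] × ℝ` and `j → ∞` for `ρ_∞^{(m,k)}` -/

section FactorContour

/-- RH-FREE. `|2z − 3|² = (2 Re z − 3)² + 4 (Im z)²`. [folklore] -/
private theorem gf_normSq_two_mul_sub_three (z : ℂ) :
    ‖2 * z - 3‖ ^ 2 = (2 * z.re - 3) ^ 2 + 4 * z.im ^ 2 := by
  rw [Complex.sq_norm, normSq_apply]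
  simp
  ring

/-- RH-FREE. For `Re z ≤ ½`: `|2z − 3|² ≥ 4(1 + (Im z)²)`. [folklore] -/
private theorem gf_four_mul_le_normSq {z : ℂ} (hz : z.re ≤ 1 / 2) : 4 * (1 + z.im ^ 2) ≤ ‖2 * z - 3‖ ^ 2 := by
  rw [gf_normSq_two_mul_sub_three]
  nlinarith

/-- RH-FREE. `γ_{m,k}(c + iy) ≠ 0` when `c` is not one of the poles `−2k − 2mn`. [folklore] -/
private theorem gf_gammaFactor_ne_zero_line {m : ℕ} (hm : 0 < m) {k : ℕ} {c : ℝ}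
    (hc : ∀ n : ℕ, c ≠ -(2 * k + 2 * m * n)) (y : ℝ) : gammaFactor m k ((c : ℂ) + y * I) ≠ 0 := by
  intro h
  obtain ⟨n, hn⟩ := (gammaFactor_eq_zero_iff hm k _).1 h
  apply hc n
  have := congrArg Complex.re hn
  simp at this
  linarith

/-- RH-FREE. The integrand `ρ_∞^{(m,k)}(z)(2z+1)^ℓ(2z−3)^{−ℓ−2}` is complex differentiable off the poles in
`Re z < 3/2`. [folklore] -/
private theorem gf_differentiableAt_integrand {m : ℕ} (hm : 0 < m) (k : ℕ) {z : ℂ}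
    (hz : gammaFactor m k z ≠ 0) (hz' : z.re < 3 / 2) (ℓ : ℕ) :
    DifferentiableAt ℂ (fun w : ℂ => rhoFactor m k w * ((2 * w + 1) ^ ℓ / (2 * w - 3) ^ (ℓ + 2))) z := by
  have h3 : (2 * z - 3) ^ (ℓ + 2) ≠ 0 := by
    apply pow_ne_zero
    intro h
    have := congrArg Complex.re h
    simp at this
    linarith
  refine (differentiableAt_rhoFactor hm k hz).mul ?_
  refine DifferentiableAt.div ?_ ?_ h3 <;> fun_prop

/-- RH-FREE. Integrability of the integrand along a vertical line `Re z = c ≤ ½` avoiding the poles, given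
`|ρ_∞^{(m,k)}| ≤ B` there. [folklore] -/
private theorem gf_integrable_line {m : ℕ} (hm : 0 < m) (k : ℕ) {c B : ℝ} (hcle : c ≤ 1 / 2)
    (hc : ∀ n : ℕ, c ≠ -(2 * k + 2 * m * n)) (ℓ : ℕ)
    (hB : ∀ y : ℝ, ‖rhoFactor m k ((c : ℂ) + y * I)‖ ≤ B) :
    Integrable fun y : ℝ => rhoFactor m k ((c : ℂ) + y * I) *
      ((2 * ((c : ℂ) + y * I) + 1) ^ ℓ / (2 * ((c : ℂ) + y * I) - 3) ^ (ℓ + 2)) := by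
  have hB0 : 0 ≤ B := (norm_nonneg _).trans (hB 0)
  have hcont : Continuous fun y : ℝ => rhoFactor m k ((c : ℂ) + y * I) *
      ((2 * ((c : ℂ) + y * I) + 1) ^ ℓ / (2 * ((c : ℂ) + y * I) - 3) ^ (ℓ + 2)) := by
    refine continuous_iff_continuousAt.2 fun y => ?_
    have hG := gf_gammaFactor_ne_zero_line hm hc y
    have hre : ((c : ℂ) + y * I).re < 3 / 2 := by simp; linarith
    have hline : Continuous fun y : ℝ => (c : ℂ) + y * I := by fun_prop
    exact ContinuousAt.comp (g := fun w : ℂ => rhoFactor m k w * ((2 * w + 1) ^ ℓ / (2 * w - 3) ^ (ℓ + 2)))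
      (f := fun y : ℝ => (c : ℂ) + y * I) (x := y) (gf_differentiableAt_integrand hm k hG hre ℓ).continuousAt
      hline.continuousAt
  refine Integrable.mono' ((integrable_inv_one_add_sq.const_mul (B / 4))) hcont.aestronglyMeasurable
    (Eventually.of_forall fun y => ?_)
  have hre : ((c : ℂ) + y * I).re ≤ 1 / 2 := by simpa using hcle
  have h4 := gf_four_mul_le_normSq hre
  simp only [add_im, ofReal_im, mul_im, ofReal_re, I_im, mul_one, I_re, mul_zero, add_zero, zero_add] at h4
  rw [norm_mul]
  calc ‖rhoFactor m k ((c : ℂ) + y * I)‖ *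
        ‖(2 * ((c : ℂ) + y * I) + 1) ^ ℓ / (2 * ((c : ℂ) + y * I) - 3) ^ (ℓ + 2)‖
      ≤ B * (‖2 * ((c : ℂ) + y * I) - 3‖ ^ 2)⁻¹ :=
        mul_le_mul (hB y) (norm_ratFactor_le hre ℓ) (norm_nonneg _) hB0
    _ ≤ B * (4 * (1 + y ^ 2))⁻¹ := mul_le_mul_of_nonneg_left (inv_anti₀ (by positivity) h4) hB0
    _ = B / 4 * (1 + y ^ 2)⁻¹ := by rw [mul_inv]; ring

/-- RH-FREE. `∫_ℝ dy/(c² + 4y²) = π/(2c)` (`c > 0`). [folklore] -/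
private theorem gf_integral_inv_sq_add_four_mul_sq {c : ℝ} (hc : 0 < c) :
    ∫ y : ℝ, (c ^ 2 + 4 * y ^ 2)⁻¹ = π / (2 * c) := by
  have h : (fun y : ℝ => (c ^ 2 + 4 * y ^ 2)⁻¹) =
      fun y : ℝ => (c ^ 2)⁻¹ * (fun u : ℝ => (1 + u ^ 2)⁻¹) (2 / c * y) := by
    funext y
    simp only
    rw [← mul_inv]
    congr 1
    field_simp
    ring
  rw [h, integral_const_mul, Measure.integral_comp_mul_left (fun u : ℝ => (1 + u ^ 2)⁻¹) (2 / c),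
    integral_univ_inv_one_add_sq, smul_eq_mul, inv_div, abs_of_pos (by positivity)]
  field_simp

/-- RH-FREE. **The residue theorem on `C_{R,j}` for `ρ_∞^{(m,k)}`, `R → ∞`** (tree
`Literature.Analysis.Complex.integral_vertical_sub_eq_sum_of_simplePoles` on `½ − 2mj ≤ Re z ≤ ½` with the
`j` simple poles `p_n = −2k − 2mn`, `n < j`; given residues `r_n` in the concrete form `ρ = Φ/(z − p_n)`):
`∫_ℝ F(½+iy)dy − ∫_ℝ F(½−2mj+iy)dy = 2π Σ_{n<j} r_n (2p_n+1)^ℓ(2p_n−3)^{−ℓ−2}`.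
[cite: ConnesConsani2021QuasiInner, §2 (arXiv chunk p0005:L52–L108) with Lemma 4.7 (p0014:L56)] -/
theorem integral_rhoFactor_line_sub_eq_sum {m : ℕ} (hm : 0 < m) {k : ℕ} (hk : k < m) (r : ℕ → ℂ)
    (hpole : ∀ n : ℕ, ∃ Φ : ℂ → ℂ,
      DifferentiableOn ℂ Φ (Metric.ball (-(2 * (k : ℂ) + 2 * (m : ℂ) * (n : ℂ))) 1) ∧
      Φ (-(2 * (k : ℂ) + 2 * (m : ℂ) * (n : ℂ))) = r n ∧
      ∀ z ∈ Metric.ball (-(2 * (k : ℂ) + 2 * (m : ℂ) * (n : ℂ))) 1, z ≠ -(2 * (k : ℂ) + 2 * (m : ℂ) * (n : ℂ)) →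
        rhoFactor m k z = Φ z / (z - -(2 * (k : ℂ) + 2 * (m : ℂ) * (n : ℂ))))
    (ℓ j : ℕ) (hj : 1 ≤ j) :
    (∫ y : ℝ, rhoFactor m k ((((1 / 2 : ℝ)) : ℂ) + y * I) *
        ((2 * ((((1 / 2 : ℝ)) : ℂ) + y * I) + 1) ^ ℓ / (2 * ((((1 / 2 : ℝ)) : ℂ) + y * I) - 3) ^ (ℓ + 2))) -
      ∫ y : ℝ, rhoFactor m k ((((1 / 2 - 2 * m * j : ℝ)) : ℂ) + y * I) *
        ((2 * ((((1 / 2 - 2 * m * j : ℝ)) : ℂ) + y * I) + 1) ^ ℓ /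
          (2 * ((((1 / 2 - 2 * m * j : ℝ)) : ℂ) + y * I) - 3) ^ (ℓ + 2)) =
      2 * π * ∑ n ∈ Finset.range j, r n *
        ((2 * (-(2 * (k : ℂ) + 2 * (m : ℂ) * (n : ℂ))) + 1) ^ ℓ /
          (2 * (-(2 * (k : ℂ) + 2 * (m : ℂ) * (n : ℂ))) - 3) ^ (ℓ + 2)) := by
  classical
  have hm0 : (0 : ℝ) < m := Nat.cast_pos.mpr hm
  have hm' : (m : ℂ) ≠ 0 := Nat.cast_ne_zero.mpr hm.ne'
  have hk1 : (k : ℝ) + 1 ≤ m := by exact_mod_cast hk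
  have hj1 : (1 : ℝ) ≤ j := by exact_mod_cast hj
  have hab : (1 / 2 - 2 * m * j : ℝ) < 1 / 2 := by nlinarith
  set F : ℂ → ℂ := fun w => rhoFactor m k w * ((2 * w + 1) ^ ℓ / (2 * w - 3) ^ (ℓ + 2)) with hF
  set R : ℂ → ℂ := fun w => (2 * w + 1) ^ ℓ / (2 * w - 3) ^ (ℓ + 2) with hR
  set P : ℕ → ℂ := fun n => -(2 * (k : ℂ) + 2 * (m : ℂ) * (n : ℂ)) with hP
  set rf : ℂ → ℂ := fun q => r ⌊(-q.re - 2 * k) / (2 * m)⌋₊ * R q with hrf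
  set S : Finset ℂ := (Finset.range j).image P with hS
  set U : Set ℂ := re ⁻¹' Ioo (1 / 4 - 2 * m * j) 1 with hU
  have hPre : ∀ n : ℕ, (P n).re = -(2 * k + 2 * m * n) := by intro n; simp [hP]
  have hinj : Set.InjOn P (Finset.range j : Set ℕ) := by
    intro x _ y _ h
    have h' := congrArg Complex.re h
    rw [hPre, hPre] at h'
    have : (x : ℝ) = y := by nlinarith
    exact_mod_cast this
  have hrn : ∀ n : ℕ, rf (P n) = r n * R (P n) := by
    intro n
    simp only [hrf]
    congr 2
    rw [hPre, show (-(-(2 * (k : ℝ) + 2 * m * n)) - 2 * k) / (2 * m) = (n : ℝ) by field_simp; ring,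
      Nat.floor_natCast]
  have key := Literature.Analysis.Complex.integral_vertical_sub_eq_sum_of_simplePoles (F := F) hab S rf U
    (isOpen_Ioo.preimage Complex.continuous_re) ?hKU ?hSin ?hFd ?hpole ?hinta ?hintb ?hdecay
  · rw [hS, Finset.sum_image hinj] at key
    simp only [hrn] at key
    simpa [hF, hR, hP] using key
  case hKU =>
    intro z hz
    simp only [hU, mem_preimage, mem_Ioo, mem_Icc] at hz ⊢
    constructor <;> linarith [hz.1, hz.2]
  case hSin =>
    intro q hq
    simp only [hS, Finset.mem_image, Finset.mem_range] at hq
    obtain ⟨n, hn, rfl⟩ := hq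
    have hn' : (n : ℝ) + 1 ≤ j := by exact_mod_cast hn
    rw [hPre, mem_Ioo]
    constructor
    · nlinarith [n.cast_nonneg (α := ℝ), k.cast_nonneg (α := ℝ)]
    · nlinarith [n.cast_nonneg (α := ℝ), k.cast_nonneg (α := ℝ)]
  case hFd =>
    intro z hz
    obtain ⟨hzU, hzS⟩ := hz
    simp only [hU, mem_preimage, mem_Ioo] at hzU
    have hG : gammaFactor m k z ≠ 0 := by
      intro h
      obtain ⟨n, hn⟩ := (gammaFactor_eq_zero_iff hm k z).1 h
      apply hzS
      simp only [hS, Finset.coe_image, Finset.coe_range, mem_image, mem_Iio]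
      refine ⟨n, ?_, by rw [hn, hP]; ring⟩
      have hzre : z.re = -(2 * k + 2 * n * m) := by
        have := congrArg Complex.re hn
        simp at this
        linarith
      by_contra hnj
      have : (j : ℝ) ≤ n := by exact_mod_cast not_lt.1 hnj
      nlinarith [hzU.1, k.cast_nonneg (α := ℝ)]
    exact (gf_differentiableAt_integrand hm k hG (by linarith [hzU.2]) ℓ).differentiableWithinAt
  case hpole =>
    intro q hq
    simp only [hS, Finset.mem_image, Finset.mem_range] at hq
    obtain ⟨n, hn, rfl⟩ := hq
    obtain ⟨Φ, hΦd, hΦv, hΦeq⟩ := hpole n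
    refine ⟨fun w => Φ w * R w, Metric.ball (P n) 1, Metric.ball_mem_nhds _ one_pos, ?_, ?_, ?_⟩
    · intro w hw
      have hre : w.re < 3 / 2 := by
        rw [Metric.mem_ball, dist_eq_norm] at hw
        have h1 : |(w - P n).re| < 1 := (abs_re_le_norm _).trans_lt hw
        rw [abs_lt, sub_re, hPre] at h1
        nlinarith [h1.2, n.cast_nonneg (α := ℝ), k.cast_nonneg (α := ℝ)]
      have h3 : (2 * w - 3) ^ (ℓ + 2) ≠ 0 := by
        apply pow_ne_zero
        intro h
        have := congrArg Complex.re h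
        simp at this
        linarith
      have hRd : DifferentiableAt ℂ R w := by
        simp only [hR]
        refine DifferentiableAt.div ?_ ?_ h3 <;> fun_prop
      exact (hΦd w hw).mul hRd.differentiableWithinAt
    · rw [hrn n]
      simp only [hP]
      rw [hΦv]
    · intro w hw hwn
      simp only [hF]
      rw [hΦeq w hw hwn]
      ring
  case hinta =>
    refine gf_integrable_line hm k hab.le ?_ ℓ (fun y => norm_rhoFactor_leftLine_le hm hk j y)
    intro n h
    have h2 : (1 : ℝ) = 4 * ((m : ℝ) * j) - 4 * k - 4 * ((m : ℝ) * n) := by linarith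
    have h3 : (1 : ℤ) = 4 * ((m : ℤ) * j) - 4 * k - 4 * ((m : ℤ) * n) := by exact_mod_cast h2
    omega
  case hintb =>
    refine gf_integrable_line (B := 1) hm k le_rfl ?_ ℓ ?_
    · intro n h
      nlinarith [n.cast_nonneg (α := ℝ), k.cast_nonneg (α := ℝ)]
    · intro y
      rw [show ((((1 / 2 : ℝ)) : ℂ)) = 1 / 2 by push_cast; ring]
      exact (lemma_4_7_norm hm k y).le
  case hdecay =>
    intro ε hε
    obtain ⟨K, hK, hKb⟩ := exists_norm_rhoFactor_le_of_le_abs_im hm k (1 / 2 - 2 * m * j)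
    refine ⟨max (2 * m) (Real.sqrt (K / ε)), fun T hT x hx => ?_⟩
    have hT2 : 2 * (m : ℝ) ≤ |T| := le_trans (le_max_left _ _) hT
    have hTK : Real.sqrt (K / ε) ≤ |T| := le_trans (le_max_right _ _) hT
    have hre : ((x : ℂ) + T * I).re ≤ 1 / 2 := by simpa using hx.2
    have h4 := gf_four_mul_le_normSq hre
    simp only [add_im, ofReal_im, mul_im, ofReal_re, I_im, mul_one, I_re, mul_zero, add_zero, zero_add] at h4
    have hT2' : K / ε ≤ T ^ 2 := by
      have h0 : 0 ≤ Real.sqrt (K / ε) := Real.sqrt_nonneg _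
      have := mul_self_le_mul_self h0 hTK
      rw [← pow_two, Real.sq_sqrt (by positivity), ← pow_two, sq_abs] at this
      exact this
    simp only [hF]
    rw [norm_mul]
    calc ‖rhoFactor m k ((x : ℂ) + T * I)‖ *
          ‖(2 * ((x : ℂ) + T * I) + 1) ^ ℓ / (2 * ((x : ℂ) + T * I) - 3) ^ (ℓ + 2)‖
        ≤ K * (‖2 * ((x : ℂ) + T * I) - 3‖ ^ 2)⁻¹ :=
          mul_le_mul (hKb x hx T hT2) (norm_ratFactor_le hre ℓ) (norm_nonneg _) hK.le
      _ ≤ K * (4 * (1 + T ^ 2))⁻¹ := by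
          refine mul_le_mul_of_nonneg_left ?_ hK.le
          exact inv_anti₀ (by positivity) h4
      _ ≤ ε := by
          rw [← div_eq_mul_inv, div_le_iff₀ (by positivity)]
          have : K ≤ ε * T ^ 2 := by
            have := mul_le_mul_of_nonneg_left hT2' hε.le
            rwa [mul_div_cancel₀ _ hε.ne'] at this
          nlinarith

/-- RH-FREE. **The integral over the left side `Re z = ½ − 2mj` tends to `0`**:
`|∫_ℝ F(½−2mj+iy)dy| ≤ (16π²/3)⁴ · π/(2(4mj+2)) → 0`.
[cite: ConnesConsani2021QuasiInner, §2 (arXiv chunk p0005:L80–L88) with Lemma 4.7 (p0014:L56)] -/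
theorem tendsto_integral_rhoFactor_leftLine {m : ℕ} (hm : 0 < m) {k : ℕ} (hk : k < m) (ℓ : ℕ) :
    Tendsto (fun j : ℕ => ∫ y : ℝ, rhoFactor m k ((((1 / 2 - 2 * m * j : ℝ)) : ℂ) + y * I) *
        ((2 * ((((1 / 2 - 2 * m * j : ℝ)) : ℂ) + y * I) + 1) ^ ℓ /
          (2 * ((((1 / 2 - 2 * m * j : ℝ)) : ℂ) + y * I) - 3) ^ (ℓ + 2))) atTop (𝓝 0) := by
  have hm0 : (0 : ℝ) < m := Nat.cast_pos.mpr hm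
  set C : ℝ := (16 * π ^ 2 / 3) ^ 4 with hC
  have hπ := Real.pi_pos
  have hbase : (1 : ℝ) ≤ 16 * π ^ 2 / 3 := by nlinarith [Real.pi_gt_three]
  have hbound : ∀ j : ℕ, ‖∫ y : ℝ, rhoFactor m k ((((1 / 2 - 2 * m * j : ℝ)) : ℂ) + y * I) *
        ((2 * ((((1 / 2 - 2 * m * j : ℝ)) : ℂ) + y * I) + 1) ^ ℓ /
          (2 * ((((1 / 2 - 2 * m * j : ℝ)) : ℂ) + y * I) - 3) ^ (ℓ + 2))‖ ≤
      C * (π / (2 * (4 * m * j + 2))) := by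
    intro j
    have hc : (0 : ℝ) < 4 * m * j + 2 := by positivity
    have hg : Integrable fun y : ℝ => C * ((4 * m * j + 2) ^ 2 + 4 * y ^ 2)⁻¹ := by
      have hcont : Continuous fun y : ℝ => ((4 * (m : ℝ) * j + 2) ^ 2 + 4 * y ^ 2)⁻¹ :=
        Continuous.inv₀ (by fun_prop) fun y => by positivity
      refine (Integrable.mono' (integrable_inv_one_add_sq.const_mul (4⁻¹))
        hcont.aestronglyMeasurable (Eventually.of_forall fun y => ?_)).const_mul C
      rw [Real.norm_eq_abs, abs_of_pos (by positivity)]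
      have h2 : (2 : ℝ) ≤ 4 * (m : ℝ) * j + 2 := by
        have : (0 : ℝ) ≤ 4 * (m : ℝ) * j := by positivity
        linarith
      have : 4 * (1 + y ^ 2) ≤ (4 * (m : ℝ) * j + 2) ^ 2 + 4 * y ^ 2 := by nlinarith [h2]
      calc ((4 * (m : ℝ) * j + 2) ^ 2 + 4 * y ^ 2)⁻¹ ≤ (4 * (1 + y ^ 2))⁻¹ := inv_anti₀ (by positivity) this
        _ = 4⁻¹ * (1 + y ^ 2)⁻¹ := mul_inv _ _
    refine (norm_integral_le_of_norm_le hg (Eventually.of_forall fun y => ?_)).trans (le_of_eq ?_)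
    · have hre : ((((1 / 2 - 2 * m * j : ℝ)) : ℂ) + y * I).re ≤ 1 / 2 := by
        simp; positivity
      rw [norm_mul]
      have hsq : ‖2 * ((((1 / 2 - 2 * m * j : ℝ)) : ℂ) + y * I) - 3‖ ^ 2 =
          (4 * m * j + 2) ^ 2 + 4 * y ^ 2 := by
        rw [gf_normSq_two_mul_sub_three]
        simp
        ring
      calc ‖rhoFactor m k ((((1 / 2 - 2 * m * j : ℝ)) : ℂ) + y * I)‖ *
            ‖(2 * ((((1 / 2 - 2 * m * j : ℝ)) : ℂ) + y * I) + 1) ^ ℓ /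
              (2 * ((((1 / 2 - 2 * m * j : ℝ)) : ℂ) + y * I) - 3) ^ (ℓ + 2)‖
          ≤ (16 * π ^ 2 / 3) ^ min j 4 *
              (‖2 * ((((1 / 2 - 2 * m * j : ℝ)) : ℂ) + y * I) - 3‖ ^ 2)⁻¹ :=
            mul_le_mul (norm_rhoFactor_leftLine_le hm hk j y) (norm_ratFactor_le hre ℓ) (norm_nonneg _)
              (by positivity)
        _ ≤ C * ((4 * m * j + 2) ^ 2 + 4 * y ^ 2)⁻¹ := by
            rw [hsq]
            refine mul_le_mul_of_nonneg_right ?_ (by positivity)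
            exact pow_le_pow_right₀ hbase (min_le_right j 4)
    · rw [integral_const_mul, gf_integral_inv_sq_add_four_mul_sq hc]
  have hlim : Tendsto (fun j : ℕ => C * (π / (2 * (4 * m * (j : ℝ) + 2)))) atTop (𝓝 0) := by
    have h1 : Tendsto (fun j : ℕ => 2 * (4 * m * (j : ℝ) + 2)) atTop atTop := by
      have h8 : Tendsto (fun j : ℕ => 8 * m * (j : ℝ) + 4) atTop atTop :=
        tendsto_atTop_add_const_right _ 4
          (tendsto_natCast_atTop_atTop.const_mul_atTop (by positivity : (0:ℝ) < 8 * m))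
      refine h8.congr fun j => ?_
      ring
    have h2 : Tendsto (fun j : ℕ => π / (2 * (4 * m * (j : ℝ) + 2))) atTop (𝓝 0) :=
      tendsto_const_nhds.div_atTop h1
    simpa using h2.const_mul C
  exact squeeze_zero_norm hbound hlim

/-- RH-FREE. **`∫_{∂ℂ₋} ρ_∞^{(m,k)}(z)(2z+1)^ℓ(2z−3)^{−ℓ−2}` as the series of residues** (the residue theorem on
`C_{R,j}`, `R → ∞`, `j → ∞`): `∫_ℝ F(½+iy)dy = 2π Σ_{n∈ℕ} r_n (2p_n+1)^ℓ(2p_n−3)^{−ℓ−2}` whenever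
`Σ|r_n| < ∞`. [cite: ConnesConsani2021QuasiInner, §2 (arXiv chunk p0005:L88–L108) with Lemma 4.7 (p0014:L56)] -/
theorem integral_rhoFactor_criticalLine_eq_tsum {m : ℕ} (hm : 0 < m) {k : ℕ} (hk : k < m) (r : ℕ → ℂ)
    (hpole : ∀ n : ℕ, ∃ Φ : ℂ → ℂ,
      DifferentiableOn ℂ Φ (Metric.ball (-(2 * (k : ℂ) + 2 * (m : ℂ) * (n : ℂ))) 1) ∧
      Φ (-(2 * (k : ℂ) + 2 * (m : ℂ) * (n : ℂ))) = r n ∧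
      ∀ z ∈ Metric.ball (-(2 * (k : ℂ) + 2 * (m : ℂ) * (n : ℂ))) 1, z ≠ -(2 * (k : ℂ) + 2 * (m : ℂ) * (n : ℂ)) →
        rhoFactor m k z = Φ z / (z - -(2 * (k : ℂ) + 2 * (m : ℂ) * (n : ℂ))))
    (hsum : Summable fun n : ℕ => ‖r n‖) (ℓ : ℕ) :
    ∫ y : ℝ, rhoFactor m k ((((1 / 2 : ℝ)) : ℂ) + y * I) *
        ((2 * ((((1 / 2 : ℝ)) : ℂ) + y * I) + 1) ^ ℓ / (2 * ((((1 / 2 : ℝ)) : ℂ) + y * I) - 3) ^ (ℓ + 2)) =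
      2 * π * ∑' n : ℕ, r n *
        ((2 * (-(2 * (k : ℂ) + 2 * (m : ℂ) * (n : ℂ))) + 1) ^ ℓ /
          (2 * (-(2 * (k : ℂ) + 2 * (m : ℂ) * (n : ℂ))) - 3) ^ (ℓ + 2)) := by
  set Ib : ℂ := ∫ y : ℝ, rhoFactor m k ((((1 / 2 : ℝ)) : ℂ) + y * I) *
        ((2 * ((((1 / 2 : ℝ)) : ℂ) + y * I) + 1) ^ ℓ / (2 * ((((1 / 2 : ℝ)) : ℂ) + y * I) - 3) ^ (ℓ + 2))
    with hIb
  set L : ℕ → ℂ := fun j => ∫ y : ℝ, rhoFactor m k ((((1 / 2 - 2 * m * j : ℝ)) : ℂ) + y * I) *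
        ((2 * ((((1 / 2 - 2 * m * j : ℝ)) : ℂ) + y * I) + 1) ^ ℓ /
          (2 * ((((1 / 2 - 2 * m * j : ℝ)) : ℂ) + y * I) - 3) ^ (ℓ + 2)) with hL
  set term : ℕ → ℂ := fun n => r n *
        ((2 * (-(2 * (k : ℂ) + 2 * (m : ℂ) * (n : ℂ))) + 1) ^ ℓ /
          (2 * (-(2 * (k : ℂ) + 2 * (m : ℂ) * (n : ℂ))) - 3) ^ (ℓ + 2)) with hterm
  have hsum' : Summable term := by
    refine Summable.of_norm_bounded hsum fun n => ?_
    have hre : (-(2 * (k : ℂ) + 2 * (m : ℂ) * (n : ℂ))).re ≤ 1 / 2 := by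
      simp; nlinarith [n.cast_nonneg (α := ℝ), k.cast_nonneg (α := ℝ), (Nat.cast_pos.mpr hm : (0:ℝ) < m)]
    have h9 : (‖2 * (-(2 * (k : ℂ) + 2 * (m : ℂ) * (n : ℂ))) - 3‖ ^ 2)⁻¹ ≤ 1 := by
      have h4 := gf_four_mul_le_normSq hre
      have : (4 : ℝ) ≤ ‖2 * (-(2 * (k : ℂ) + 2 * (m : ℂ) * (n : ℂ))) - 3‖ ^ 2 :=
        le_trans (by nlinarith [sq_nonneg (-(2 * (k : ℂ) + 2 * (m : ℂ) * (n : ℂ))).im]) h4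
      exact inv_le_one_of_one_le₀ (by linarith)
    rw [hterm]
    dsimp only
    rw [norm_mul]
    calc ‖r n‖ * _ ≤ ‖r n‖ * 1 :=
          mul_le_mul_of_nonneg_left ((norm_ratFactor_le hre ℓ).trans h9) (norm_nonneg _)
      _ = ‖r n‖ := mul_one _
  have hS : HasSum term (∑' n, term n) := hsum'.hasSum
  have hconst : ∀ᶠ j : ℕ in atTop, L j + 2 * π * ∑ n ∈ Finset.range j, term n = Ib := by
    filter_upwards [eventually_ge_atTop 1] with j hj
    have h : Ib - L j = 2 * π * ∑ n ∈ Finset.range j, term n :=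
      integral_rhoFactor_line_sub_eq_sum hm hk r hpole ℓ j hj
    linear_combination (-1 : ℂ) * h
  have hlim : Tendsto (fun j : ℕ => L j + 2 * π * ∑ n ∈ Finset.range j, term n) atTop
      (𝓝 (0 + 2 * π * ∑' n, term n)) :=
    (tendsto_integral_rhoFactor_leftLine hm hk ℓ).add (hS.tendsto_sum_nat.const_mul _)
  rw [zero_add] at hlim
  have hlim' : Tendsto (fun j : ℕ => L j + 2 * π * ∑ n ∈ Finset.range j, term n) atTop (𝓝 Ib) :=
    tendsto_const_nhds.congr' (EventuallyEq.symm hconst)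
  exact tendsto_nhds_unique hlim' hlim

/-- RH-FREE. **The negative Fourier coefficients of `κ^{(m,k)} = ρ_∞^{(m,k)} ∘ ψ`** (the analogue of display
«aminusk» for the factor `ρ_∞^{(m,k)}`): for every `ℓ`,
`κ̂^{(m,k)}(−ℓ−1) = Σ_n c_n x_n^ℓ`, `c_n = −8 r_n/(2p_n−3)²`, `x_n = ψ⁻¹(p_n) = (2p_n+1)/(2p_n−3)`, `p_n = −2k−2mn`.
[cite: ConnesConsani2021QuasiInner, §2 display «aminusk» (arXiv chunk p0005:L104–L115) with Lemma 4.7 (p0014:L56)] -/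
theorem hasSum_fourierCoeff_rhoFactor {m : ℕ} (hm : 0 < m) {k : ℕ} (hk : k < m) (r : ℕ → ℂ)
    (hpole : ∀ n : ℕ, ∃ Φ : ℂ → ℂ,
      DifferentiableOn ℂ Φ (Metric.ball (-(2 * (k : ℂ) + 2 * (m : ℂ) * (n : ℂ))) 1) ∧
      Φ (-(2 * (k : ℂ) + 2 * (m : ℂ) * (n : ℂ))) = r n ∧
      ∀ z ∈ Metric.ball (-(2 * (k : ℂ) + 2 * (m : ℂ) * (n : ℂ))) 1, z ≠ -(2 * (k : ℂ) + 2 * (m : ℂ) * (n : ℂ)) →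
        rhoFactor m k z = Φ z / (z - -(2 * (k : ℂ) + 2 * (m : ℂ) * (n : ℂ))))
    (hsum : Summable fun n : ℕ => ‖r n‖) (ℓ : ℕ) :
    HasSum (fun n : ℕ => (-8 * r n / (2 * (-(2 * (k : ℂ) + 2 * (m : ℂ) * (n : ℂ))) - 3) ^ 2) *
        ((2 * (-(2 * (k : ℂ) + 2 * (m : ℂ) * (n : ℂ))) + 1) / (2 * (-(2 * (k : ℂ) + 2 * (m : ℂ) * (n : ℂ))) - 3)) ^ ℓ)
      (fourierCoeff (T := 1) (circleRestrict 1 (rhoFactor m k ∘ cayley)) (-((ℓ + 1 : ℕ) : ℤ))) := by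
  have hπ : (π : ℂ) ≠ 0 := ofReal_ne_zero.mpr Real.pi_pos.ne'
  -- the terms
  set term : ℕ → ℂ := fun n => r n *
        ((2 * (-(2 * (k : ℂ) + 2 * (m : ℂ) * (n : ℂ))) + 1) ^ ℓ /
          (2 * (-(2 * (k : ℂ) + 2 * (m : ℂ) * (n : ℂ))) - 3) ^ (ℓ + 2)) with hterm
  have hsum' : Summable term := by
    refine Summable.of_norm_bounded hsum fun n => ?_
    have hre : (-(2 * (k : ℂ) + 2 * (m : ℂ) * (n : ℂ))).re ≤ 1 / 2 := by
      simp; nlinarith [n.cast_nonneg (α := ℝ), k.cast_nonneg (α := ℝ), (Nat.cast_pos.mpr hm : (0:ℝ) < m)]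
    have h9 : (‖2 * (-(2 * (k : ℂ) + 2 * (m : ℂ) * (n : ℂ))) - 3‖ ^ 2)⁻¹ ≤ 1 := by
      have h4 := gf_four_mul_le_normSq hre
      have : (4 : ℝ) ≤ ‖2 * (-(2 * (k : ℂ) + 2 * (m : ℂ) * (n : ℂ))) - 3‖ ^ 2 :=
        le_trans (by nlinarith [sq_nonneg (-(2 * (k : ℂ) + 2 * (m : ℂ) * (n : ℂ))).im]) h4
      exact inv_le_one_of_one_le₀ (by linarith)
    rw [hterm]
    dsimp only
    rw [norm_mul]
    calc ‖r n‖ * _ ≤ ‖r n‖ * 1 :=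
          mul_le_mul_of_nonneg_left ((norm_ratFactor_le hre ℓ).trans h9) (norm_nonneg _)
      _ = ‖r n‖ := mul_one _
  have hterm' : ∀ n : ℕ, (-8 * r n / (2 * (-(2 * (k : ℂ) + 2 * (m : ℂ) * (n : ℂ))) - 3) ^ 2) *
      ((2 * (-(2 * (k : ℂ) + 2 * (m : ℂ) * (n : ℂ))) + 1) / (2 * (-(2 * (k : ℂ) + 2 * (m : ℂ) * (n : ℂ))) - 3)) ^ ℓ
      = -8 * term n := by
    intro n
    have h3 : (2 * (-(2 * (k : ℂ) + 2 * (m : ℂ) * (n : ℂ))) - 3) ≠ 0 := by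
      intro h
      have := congrArg Complex.re h
      simp at this
      nlinarith [n.cast_nonneg (α := ℝ), k.cast_nonneg (α := ℝ), (Nat.cast_pos.mpr hm : (0:ℝ) < m)]
    rw [hterm]
    dsimp only
    rw [div_pow, pow_add]
    field_simp
  simp_rw [hterm']
  -- the change of variables and the line integral
  have hcov := fourierCoeff_circleRestrict_neg_eq_integral (rhoFactor m k ∘ cayley) (ℓ + 1)
  have hpt : ∀ t : ℝ, (((π⁻¹ * (1 + t ^ 2)⁻¹ : ℝ)) : ℂ) *
      (cayleyInv (1 / 2 + t * I) ^ (ℓ + 1) * (rhoFactor m k ∘ cayley) (cayleyInv (1 / 2 + t * I))) =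
      -(4 / π : ℂ) * (rhoFactor m k ((((1 / 2 : ℝ)) : ℂ) + t * I) *
        ((2 * ((((1 / 2 : ℝ)) : ℂ) + t * I) + 1) ^ ℓ / (2 * ((((1 / 2 : ℝ)) : ℂ) + t * I) - 3) ^ (ℓ + 2))) := by
    intro t
    set z : ℂ := 1 / 2 + (t : ℂ) * I with hzD
    have hz : z ≠ 3 / 2 := by
      intro h
      have := congrArg Complex.re h
      rw [hzD] at this
      simp at this
      norm_num at this
    have h12 : ((((1 / 2 : ℝ)) : ℂ)) + (t : ℂ) * I = z := by rw [hzD]; push_cast; ring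
    rw [h12, Function.comp_apply, cayley_cayleyInv hz, cayleyInv]
    set A : ℂ := 2 * z + 1 with hA
    set B : ℂ := 2 * z - 3 with hB
    have hA0 : A ≠ 0 := by
      intro h
      have := congrArg Complex.re h
      rw [hA, hzD] at this
      norm_num at this
    have hB0 : B ≠ 0 := by
      intro h
      have := congrArg Complex.re h
      rw [hB, hzD] at this
      norm_num at this
    have hq : (((1 + t ^ 2 : ℝ)) : ℂ) = -(A * B) / 4 := by
      rw [hA, hB, hzD]
      push_cast
      linear_combination ((t : ℂ) ^ 2) * I_sq
    have hcast : (((π⁻¹ * (1 + t ^ 2)⁻¹ : ℝ)) : ℂ) = (π : ℂ)⁻¹ * ((((1 + t ^ 2 : ℝ)) : ℂ))⁻¹ := by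
      push_cast; ring
    rw [hcast, hq, div_pow]
    field_simp
    ring
  rw [hcov]
  simp_rw [hpt]
  rw [integral_const_mul, integral_rhoFactor_criticalLine_eq_tsum hm hk r hpole hsum ℓ]
  have h := (hsum'.hasSum).mul_left (-(4 / π : ℂ) * (2 * π))
  have e : -(4 / π : ℂ) * (2 * π) = -8 := by field_simp; ring
  rw [e] at h
  rw [show -(4 / π : ℂ) * (2 * π * ∑' n, term n) = -8 * ∑' n, term n by field_simp; ring]
  exact h

end FactorContour

/-! ### D. An abstract Hankel lemma (the mechanism of Theorems 2.3 and 2.1): a symbol whose negative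
Fourier coefficients are the moments `Σ_n c_n x_n^ℓ` has off-diagonal part `Σ_n c_n |ξ_{x_n}⟩⟨η_{x_n}|` -/

section HankelMechanism

/-- RH-FREE. Fourier coefficients only depend on the a.e. class. [folklore] -/
private theorem gf_fourierCoeff_congr_ae {f g : AddCircle (1:ℝ) → ℂ}
    (h : f =ᵐ[haarAddCircle (T := 1)] g) (n : ℤ) :
    fourierCoeff (T := 1) f n = fourierCoeff (T := 1) g n := by
  simp only [fourierCoeff]
  exact integral_congr_ae (by filter_upwards [h] with x hx; simp only [hx])

/-- RH-FREE. The `n`-th Fourier coefficient as a continuous linear functional on `L^∞(S¹)`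
(`u ↦ ⟨e_n | u·e_0⟩ = û(n)`). [folklore] -/
private theorem gf_fourierCoeffCLM_apply (n : ℤ) (u : Lp ℂ ∞ (haarAddCircle (T := (1:ℝ)))) :
    ((innerSL ℂ (fourierLp (T := 1) 2 n)).comp
      ((((ContinuousLinearMap.mul ℂ ℂ).holderL (haarAddCircle (T := (1:ℝ))) ∞ 2 2).flip
        (fourierLp (T := 1) 2 0)))) u = fourierCoeff (T := 1) (u : AddCircle (1:ℝ) → ℂ) n := by
  set w : Lp ℂ 2 (haarAddCircle (T := (1:ℝ))) :=
    ((((ContinuousLinearMap.mul ℂ ℂ).holderL (haarAddCircle (T := (1:ℝ))) ∞ 2 2).flip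
      (fourierLp (T := 1) 2 0))) u with hw
  have h2 : (w : AddCircle (1:ℝ) → ℂ) =ᵐ[haarAddCircle (T := 1)] (u : AddCircle (1:ℝ) → ℂ) := by
    have h1 : w = mulOp haarAddCircle u (fourierLp (T := 1) 2 0) := rfl
    rw [h1]
    filter_upwards [coeFn_mulOp haarAddCircle u (fourierLp (T := 1) 2 0), coeFn_fourierLp (T := 1) 2 0]
      with y h3 h4
    rw [h3, h4, fourier_zero, mul_one]
  rw [ContinuousLinearMap.comp_apply, innerSL_apply_apply, ← hw, ← gf_fourierCoeff_congr_ae h2 n,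
    ← fourierBasis_repr, ← coe_fourierBasis]
  exact (fourierBasis.repr_apply_apply w n).symm

/-- RH-FREE. `f_x` restricted to the circle is continuous for `|x| < 1`. [folklore] -/
private theorem gf_continuous_circleRestrict_szegoNeg {x : ℂ} (hx : ‖x‖ < 1) :
    Continuous (circleRestrict 1 (szegoNeg x)) := by
  have hinv : Continuous fun y : AddCircle (1:ℝ) => ((toCircle y : ℂ))⁻¹ :=
    Continuous.inv₀ (by fun_prop) fun y => Circle.coe_ne_zero _
  have h : circleRestrict 1 (szegoNeg x) =
      fun y : AddCircle (1:ℝ) => ((toCircle y : ℂ))⁻¹ * (1 - x * ((toCircle y : ℂ))⁻¹)⁻¹ := rfl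
  rw [h]
  refine hinv.mul (Continuous.inv₀ (continuous_const.sub (continuous_const.mul hinv)) fun y h0 => ?_)
  have h1 : ‖x * ((toCircle y : ℂ))⁻¹‖ < 1 := by
    rw [norm_mul, norm_inv, Circle.norm_coe, inv_one, mul_one]; exact hx
  rw [sub_eq_zero] at h0
  rw [← h0, norm_one] at h1
  exact lt_irrefl _ h1

/-- RH-FREE. `|f_x(v)| ≤ (1 − |x|)⁻¹` on the unit circle. [folklore] -/
private theorem gf_norm_circleRestrict_szegoNeg_le {x : ℂ} (hx : ‖x‖ < 1) (y : AddCircle (1:ℝ)) :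
    ‖circleRestrict 1 (szegoNeg x) y‖ ≤ (1 - ‖x‖)⁻¹ := by
  have hv : ‖((toCircle y : Circle) : ℂ)‖ = 1 := Circle.norm_coe _
  have h1 : 0 < 1 - ‖x‖ := by linarith
  show ‖((toCircle y : ℂ))⁻¹ * (1 - x * ((toCircle y : ℂ))⁻¹)⁻¹‖ ≤ (1 - ‖x‖)⁻¹
  rw [norm_mul, norm_inv, hv, inv_one, one_mul, norm_inv]
  refine inv_anti₀ h1 ?_
  calc 1 - ‖x‖ = ‖(1 : ℂ)‖ - ‖x * ((toCircle y : ℂ))⁻¹‖ := by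
        rw [norm_one, norm_mul, norm_inv, hv, inv_one, mul_one]
    _ ≤ ‖1 - x * ((toCircle y : ℂ))⁻¹‖ := norm_sub_norm_le _ _

/-- RH-FREE. `f_x|S¹ ∈ L^∞(S¹)`. [folklore] -/
private theorem gf_memLp_szegoNeg {x : ℂ} (hx : ‖x‖ < 1) :
    MemLp (circleRestrict 1 (szegoNeg x)) ∞ (haarAddCircle (T := 1)) :=
  memLp_top_of_bound (gf_continuous_circleRestrict_szegoNeg hx).aestronglyMeasurable _
    (ae_of_all _ (gf_norm_circleRestrict_szegoNeg_le hx))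

/-- RH-FREE. `‖f_x‖_{L^∞(S¹)} ≤ (1 − |x|)⁻¹`. [folklore] -/
private theorem gf_norm_szegoNegLinfty_le {x : ℂ} (hx : ‖x‖ < 1) :
    ‖toLpOrZero ∞ haarAddCircle (circleRestrict 1 (szegoNeg x))‖ ≤ (1 - ‖x‖)⁻¹ := by
  have h0 : 0 ≤ (1 - ‖x‖)⁻¹ := inv_nonneg.mpr (by linarith)
  rw [toLpOrZero_eq_toLp (gf_memLp_szegoNeg hx)]
  have hb := Lp.norm_le_of_ae_bound (f := (gf_memLp_szegoNeg hx).toLp _) h0 (by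
    filter_upwards [(gf_memLp_szegoNeg hx).coeFn_toLp] with y hy
    rw [hy]
    exact gf_norm_circleRestrict_szegoNeg_le hx y)
  simpa [ENNReal.toReal_top] using hb

/-- RH-FREE. The a.e. class of `f_x` in `L^∞` and in `L²` is the same function `ξ_x`. [folklore] -/
private theorem gf_coeFn_szegoNegLinfty_ae_eq_xiVec {x : ℂ} (hx : ‖x‖ < 1) :
    ((toLpOrZero ∞ haarAddCircle (circleRestrict 1 (szegoNeg x)) : Lp ℂ ∞ (haarAddCircle (T := 1))) :
        AddCircle (1:ℝ) → ℂ) =ᵐ[haarAddCircle (T := 1)]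
      ((xiVec 1 x : Lp ℂ 2 (haarAddCircle (T := 1))) : AddCircle (1:ℝ) → ℂ) := by
  have hmemTop := gf_memLp_szegoNeg hx
  have hmem2 : MemLp (circleRestrict 1 (szegoNeg x)) 2 (haarAddCircle (T := 1)) :=
    hmemTop.mono_exponent le_top
  rw [xiVec, toLpOrZero_eq_toLp hmemTop, toLpOrZero_eq_toLp hmem2]
  exact hmemTop.coeFn_toLp.trans hmem2.coeFn_toLp.symm

/-- RH-FREE. `f̂_x(−ℓ−1) = x^ℓ` for the `L^∞` class of `f_x`. [folklore] -/
private theorem gf_fourierCoeff_szegoNegLinfty {x : ℂ} (hx : ‖x‖ < 1) (ℓ : ℕ) :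
    fourierCoeff (T := 1) ((toLpOrZero ∞ haarAddCircle (circleRestrict 1 (szegoNeg x)) :
      Lp ℂ ∞ (haarAddCircle (T := 1))) : AddCircle (1:ℝ) → ℂ) (-(ℓ + 1 : ℤ)) = x ^ ℓ := by
  rw [gf_fourierCoeff_congr_ae (gf_coeFn_szegoNegLinfty_ae_eq_xiVec hx), (fourierCoeff_xiVec 1 _ hx ℓ).1]

/-- RH-FREE. A rank-one operator `|x⟩⟨y|` is compact. [folklore] -/
private theorem gf_isCompactOperator_rankOne {E : Type*} [NormedAddCommGroup E] [InnerProductSpace ℂ E]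
    (x y : E) : IsCompactOperator (InnerProductSpace.rankOne ℂ x y) := by
  refine ⟨(fun c : ℂ => c • x) '' Metric.closedBall 0 ‖y‖,
    (isCompact_closedBall (0 : ℂ) ‖y‖).image (continuous_id.smul continuous_const),
    Filter.mem_of_superset (Metric.closedBall_mem_nhds 0 one_pos) fun z hz => ?_⟩
  refine ⟨⟪y, z⟫_ℂ, ?_, (InnerProductSpace.rankOne_apply x y z).symm⟩
  rw [Metric.mem_closedBall, dist_zero_right] at hz ⊢
  calc ‖⟪y, z⟫_ℂ‖ ≤ ‖y‖ * ‖z‖ := norm_inner_le_norm y z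
    _ ≤ ‖y‖ * 1 := mul_le_mul_of_nonneg_left hz (norm_nonneg _)
    _ = ‖y‖ := mul_one _

/-- RH-FREE. **The Hankel mechanism of Theorem 2.3** (abstract form of its printed proof, p0006:L59–L68:
«The negative part of the Fourier expansion of `κ` is expressed as a linear combination of the `f_{x_n}`
while the off diagonal part is computed by Lemma 2.2»): if `u ∈ L^∞(S¹)` has negative Fourier
coefficients `û(−ℓ−1) = Σ_n c_n x_n^ℓ` (`ℓ ≥ 0`) with `|x_n| < 1` and `Σ_n |c_n|/(1 − |x_n|) < ∞`, then
`(1 − 𝒫)u𝒫 = Σ_n c_n |ξ_{x_n}⟩⟨η_{x_n}|`, norm-convergent (the model symbol `Σ c_n f_{x_n}` converges in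
`L^∞`, has the same negative coefficients, hence the same off-diagonal part, and Lemma 2.2 computes each term).
[cite: ConnesConsani2021QuasiInner, Thm 2.3 «thmkappa», proof (arXiv chunk p0006:L59–L68) with Lemma 2.2 (p0006:L11–L47)] -/
theorem hasSum_hardyOffDiag_of_hasSum_fourierCoeff (u : Lp ℂ ∞ (haarAddCircle (T := (1:ℝ))))
    {x c : ℕ → ℂ} (hx : ∀ n, ‖x n‖ < 1) (hs : Summable fun n => ‖c n‖ * (1 - ‖x n‖)⁻¹)
    (hcoef : ∀ ℓ : ℕ, HasSum (fun n => c n * x n ^ ℓ)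
      (fourierCoeff (T := 1) (u : AddCircle (1:ℝ) → ℂ) (-(ℓ + 1 : ℤ)))) :
    HasSum (fun n => c n • InnerProductSpace.rankOne ℂ (xiVec 1 (x n)) (etaVec 1 (x n)))
      (hardyOffDiag 1 u) := by
  set f : ℕ → Lp ℂ ∞ (haarAddCircle (T := (1:ℝ))) :=
    fun n => toLpOrZero ∞ haarAddCircle (circleRestrict 1 (szegoNeg (x n))) with hf
  have hsn : Summable fun n => ‖c n • f n‖ := by
    refine Summable.of_nonneg_of_le (fun n => norm_nonneg _) (fun n => ?_) hs
    rw [norm_smul]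
    exact mul_le_mul_of_nonneg_left (gf_norm_szegoNegLinfty_le (hx n)) (norm_nonneg _)
  have hv := hsn.of_norm.hasSum
  set v : Lp ℂ ∞ (haarAddCircle (T := (1:ℝ))) := ∑' n, c n • f n with hvD
  have h1 := hasSum_hardyOffDiag (T := 1) hv
  have heq : (fun n => c n • hardyOffDiag 1 (f n)) =
      fun n => c n • InnerProductSpace.rankOne ℂ (xiVec 1 (x n)) (etaVec 1 (x n)) := by
    funext n
    rw [hf]
    dsimp only
    rw [hardyOffDiag_szegoNeg (T := 1) _ (hx n)]
  rw [heq] at h1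
  -- the model symbol `v = Σ c_n f_{x_n}` has the same negative Fourier coefficients as `u`
  have hcoefv : ∀ ℓ : ℕ, fourierCoeff (T := 1) (v : AddCircle (1:ℝ) → ℂ) (-(ℓ + 1 : ℤ)) =
      fourierCoeff (T := 1) (u : AddCircle (1:ℝ) → ℂ) (-(ℓ + 1 : ℤ)) := by
    intro ℓ
    have h := ((innerSL ℂ (fourierLp (T := 1) 2 (-(ℓ + 1 : ℤ)))).comp
      ((((ContinuousLinearMap.mul ℂ ℂ).holderL (haarAddCircle (T := (1:ℝ))) ∞ 2 2).flip
        (fourierLp (T := 1) 2 0)))).hasSum hv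
    simp only [map_smul, gf_fourierCoeffCLM_apply, smul_eq_mul] at h
    have hterm : ∀ n, fourierCoeff (T := 1) (f n : AddCircle (1:ℝ) → ℂ) (-(ℓ + 1 : ℤ)) = x n ^ ℓ :=
      fun n => gf_fourierCoeff_szegoNegLinfty (hx n) ℓ
    simp only [hterm] at h
    exact h.unique (hcoef ℓ)
  have hzero : hardyOffDiag 1 (u - v) = 0 := by
    refine hardyOffDiag_eq_zero_of_fourierCoeff_neg_eq_zero 1 _ fun ℓ => ?_
    rw [← gf_fourierCoeffCLM_apply, map_sub, gf_fourierCoeffCLM_apply, gf_fourierCoeffCLM_apply, hcoefv,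
      sub_self]
  rw [← hardyOffDiagL_apply, map_sub, hardyOffDiagL_apply, hardyOffDiagL_apply, sub_eq_zero] at hzero
  rw [hzero]
  exact h1

/-- RH-FREE. **… hence `(1 − 𝒫)u𝒫` is compact** (a norm-convergent series of rank-one operators; the first
sentence of Theorem 2.1 from Theorem 2.3, p0006:L49–L57, in the same abstract form).
[cite: ConnesConsani2021QuasiInner, Thm 2.1 «thmquasiinner0» (p0005:L124) with Thm 2.3 «thmkappa» (arXiv chunk p0006:L49–L68)] -/
theorem isCompactOperator_hardyOffDiag_of_hasSum_fourierCoeff (u : Lp ℂ ∞ (haarAddCircle (T := (1:ℝ))))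
    {x c : ℕ → ℂ} (hx : ∀ n, ‖x n‖ < 1) (hs : Summable fun n => ‖c n‖ * (1 - ‖x n‖)⁻¹)
    (hcoef : ∀ ℓ : ℕ, HasSum (fun n => c n * x n ^ ℓ)
      (fourierCoeff (T := 1) (u : AddCircle (1:ℝ) → ℂ) (-(ℓ + 1 : ℤ)))) :
    IsCompactOperator (hardyOffDiag 1 u) := by
  have h := hasSum_hardyOffDiag_of_hasSum_fourierCoeff u hx hs hcoef
  have hmem : ∀ s : Finset ℕ, IsCompactOperator
      (⇑(∑ n ∈ s, c n • InnerProductSpace.rankOne ℂ (xiVec 1 (x n)) (etaVec 1 (x n)))) := by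
    intro s
    induction s using Finset.induction_on with
    | empty =>
      rw [Finset.sum_empty]
      exact isCompactOperator_zero
    | insert a s ha ih =>
      rw [Finset.sum_insert ha, FunLike.coe_add, FunLike.coe_smul]
      exact ((gf_isCompactOperator_rankOne _ _).smul _).add ih
  exact isClosed_setOf_isCompactOperator.mem_of_tendsto h (Eventually.of_forall hmem)

end HankelMechanism

/-! ### E. Lemma 4.7: `ρ_∞^{(m,k)}` is quasi-inner relative to `ℂ₋` -/

section LemmaFourSeven

/-- RH-FREE. The conformal map `ψ` is continuous off `v = 1`. [folklore] -/
private theorem gf_continuousAt_cayley {v : ℂ} (hv : v ≠ 1) : ContinuousAt cayley v := by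
  unfold cayley
  exact continuousAt_const.add ((continuousAt_id.add continuousAt_const).div
    (continuousAt_id.sub continuousAt_const) (sub_ne_zero.mpr hv))

/-- RH-FREE. `γ_{m,k}` has no pole in `Re z > 0`. [folklore] -/
private theorem gf_gammaFactor_ne_zero_of_re_pos {m : ℕ} (hm : 0 < m) (k : ℕ) {z : ℂ} (hz : 0 < z.re) :
    gammaFactor m k z ≠ 0 := by
  intro h
  obtain ⟨n, hn⟩ := (gammaFactor_eq_zero_iff hm k z).1 h
  have := congrArg Complex.re hn
  simp at this
  nlinarith [n.cast_nonneg (α := ℝ), k.cast_nonneg (α := ℝ), (Nat.cast_pos.mpr hm : (0:ℝ) < m)]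

/-- RH-FREE. The geometry of the poles in the disk: for `p = −q`, `q ≥ 0`, `x = ψ⁻¹(p) = (2p+1)/(2p−3)`
satisfies `|x| ≤ 1 − 2/(2q+3)` and `|2p − 3| = 2q + 3`. [folklore] -/
private theorem gf_pole_geometry {q : ℝ} (hq : 0 ≤ q) :
    ‖(2 * (-((q : ℝ) : ℂ)) + 1) / (2 * (-((q : ℝ) : ℂ)) - 3)‖ ≤ 1 - 2 / (2 * q + 3) ∧
      ‖2 * (-((q : ℝ) : ℂ)) - 3‖ = 2 * q + 3 := by
  have h3 : 2 * (-((q : ℝ) : ℂ)) - 3 = (((-(2 * q + 3) : ℝ)) : ℂ) := by push_cast; ring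
  have h1 : 2 * (-((q : ℝ) : ℂ)) + 1 = (((-(2 * q - 1) : ℝ)) : ℂ) := by push_cast; ring
  have hpos : 0 < 2 * q + 3 := by linarith
  rw [h3, h1, norm_div, Complex.norm_real, Complex.norm_real, Real.norm_eq_abs, Real.norm_eq_abs, abs_neg,
    abs_neg, abs_of_pos hpos]
  refine ⟨?_, rfl⟩
  rw [div_le_iff₀ hpos, show (1 - 2 / (2 * q + 3)) * (2 * q + 3) = 2 * q + 1 by field_simp; ring]
  exact abs_le.2 ⟨by linarith, by linarith⟩

/-- RH-FREE. The boundary function `κ^{(m,k)}|S¹ = ρ_∞^{(m,k)} ∘ ψ` is continuous off the point `v = 1`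
(`ψ(v)` runs over the critical line, where `γ_{m,k}` has no pole).
[cite: ConnesConsani2021QuasiInner, Lemma 4.7 (arXiv chunk p0014:L48–L56) with §2 (p0006:L87)] -/
theorem continuousOn_circleRestrict_rhoFactor {m : ℕ} (hm : 0 < m) (k : ℕ) :
    ContinuousOn (circleRestrict 1 (rhoFactor m k ∘ cayley)) {0}ᶜ := by
  intro x hx
  refine ContinuousAt.continuousWithinAt ?_
  have hv1 : ((toCircle x : Circle) : ℂ) ≠ 1 := by
    intro h
    apply hx
    have h' : toCircle x = toCircle (0 : AddCircle (1:ℝ)) := by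
      rw [toCircle_zero]; exact Circle.ext h
    exact injective_toCircle one_ne_zero h'
  have hvn : ‖((toCircle x : Circle) : ℂ)‖ = 1 := Circle.norm_coe _
  have hG : gammaFactor m k (cayley (toCircle x : ℂ)) ≠ 0 :=
    gf_gammaFactor_ne_zero_of_re_pos hm k (by rw [cayley_re_of_norm_eq_one hvn]; norm_num)
  have hc : ContinuousAt (fun y : AddCircle (1:ℝ) => ((toCircle y : Circle) : ℂ)) x :=
    (continuous_subtype_val.comp continuous_toCircle).continuousAt
  have hfun : circleRestrict 1 (rhoFactor m k ∘ cayley) =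
      (rhoFactor m k ∘ cayley) ∘ fun y : AddCircle (1:ℝ) => ((toCircle y : Circle) : ℂ) := rfl
  rw [hfun]
  exact ContinuousAt.comp (((differentiableAt_rhoFactor hm k hG).continuousAt).comp
    (gf_continuousAt_cayley hv1)) hc

/-- RH-FREE. **`κ^{(m,k)} = ρ_∞^{(m,k)} ∘ ψ` is unimodular on `S¹`** (at every point, junk value at `v = 1`
included; Lemma 4.6 (ii)). [cite: ConnesConsani2021QuasiInner, Lemma 4.7 (arXiv chunk p0014:L48–L56) with Lemma 4.6 (ii) (p0013:L84)] -/
theorem norm_circleRestrict_rhoFactor {m : ℕ} (hm : 0 < m) (k : ℕ) (x : AddCircle (1:ℝ)) :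
    ‖circleRestrict 1 (rhoFactor m k ∘ cayley) x‖ = 1 := by
  have hv : ‖((toCircle x : Circle) : ℂ)‖ = 1 := Circle.norm_coe _
  simp only [circleRestrict, Function.comp_apply]
  rw [cayley_eq_half_add_of_norm_eq_one hv]
  exact lemma_4_7_norm hm k _

/-- RH-FREE. The boundary function `κ^{(m,k)}|S¹` belongs to `L^∞(S¹)`.
[cite: ConnesConsani2021QuasiInner, Lemma 4.7 (arXiv chunk p0014:L48–L56)] -/
theorem memLp_circleRestrict_rhoFactor {m : ℕ} (hm : 0 < m) (k : ℕ) :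
    MemLp (circleRestrict 1 (rhoFactor m k ∘ cayley)) ∞ (haarAddCircle (T := 1)) :=
  memLp_top_of_bound (measurable_of_continuousOn_compl_singleton 0
    (continuousOn_circleRestrict_rhoFactor hm k)).aestronglyMeasurable 1
    (ae_of_all _ fun x => (norm_circleRestrict_rhoFactor hm k x).le)

/-- RH-FREE. **Lemma 4.7 (quasi-inner clause), PROVED**: for `0 ≤ k < m` the factor
`ρ_∞^{(m,k)}(z) = (π/m)^{1/(2m) − z/m} Γ(z/(2m)+k/m)/Γ((1−z)/(2m)+k/m)` is quasi-inner relative to `ℂ₋`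
(boundary-value form `IsQuasiInnerLeftHalfPlane`): `κ^{(m,k)}|S¹ ∈ L^∞` is unimodular and
`(1 − 𝒫)κ^{(m,k)}𝒫 = Σ_n c_n |ξ_{x_n}⟩⟨η_{x_n}|` is compact, the negative Fourier coefficients of `κ^{(m,k)}`
being `Σ_n c_n x_n^ℓ` by the residue computation of §2 run with the poles `−2k − 2mn` («The proof is the
same as for `ρ_∞` … the results of §2 continue to hold with minor changes»).  Discharges the named fact
`lemma_4_7_quasiInner` of `QuasiInnerProducts.lean`.
[cite: ConnesConsani2021QuasiInner, Lemma 4.7 (arXiv chunk p0014:L48–L56) with §2 (p0005:L34–p0006:L68)] -/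
theorem lemma_4_7_quasiInner_holds : QuasiInner.lemma_4_7_quasiInner := by
  intro m k hm hk
  have hm0 : (0 : ℝ) < m := Nat.cast_pos.mpr hm
  have hmem := memLp_circleRestrict_rhoFactor hm k
  have hae : ((toLpOrZero ∞ haarAddCircle (circleRestrict 1 (rhoFactor m k ∘ cayley)) :
      Lp ℂ ∞ (haarAddCircle (T := 1))) : AddCircle (1:ℝ) → ℂ) =ᵐ[haarAddCircle (T := 1)]
      circleRestrict 1 (rhoFactor m k ∘ cayley) := by
    rw [toLpOrZero_eq_toLp hmem]
    exact hmem.coeFn_toLp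
  refine ⟨hmem, ?_, ?_⟩
  · filter_upwards [hae] with x hx
    rw [hx]
    exact norm_circleRestrict_rhoFactor hm k x
  · -- the poles `p_n = −2k − 2mn`, their residues `E n`, the points `x_n = ψ⁻¹(p_n)` and coefficients `c_n`
    set P : ℕ → ℂ := fun n => -(2 * (k : ℂ) + 2 * (m : ℂ) * (n : ℂ)) with hP
    set E : ℕ → ℂ := fun n => 2 * (m : ℂ) * ((π : ℂ) / m) ^ (1 / (2 * (m : ℂ)) - P n / m) *
      (Complex.Gamma ((1 - P n) / (2 * (m : ℂ)) + (k : ℂ) / (m : ℂ)))⁻¹ / ((-1) ^ n * (n ! : ℂ)) with hE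
    have hpole : ∀ n : ℕ, ∃ Φ : ℂ → ℂ, DifferentiableOn ℂ Φ (Metric.ball (P n) 1) ∧ Φ (P n) = E n ∧
        ∀ z ∈ Metric.ball (P n) 1, z ≠ P n → rhoFactor m k z = Φ z / (z - P n) :=
      fun n => exists_rhoFactor_eq_div_sub_pole hm k n
    have hEs : Summable fun n : ℕ => ‖E n‖ := by
      have hmaj : Summable fun n : ℕ =>
          2 * (m : ℝ) * (π / m) ^ ((1 + 4 * k) / (2 * m) : ℝ) * ((π / m) ^ 2) ^ n / n ! := by
        have := (Real.summable_pow_div_factorial ((π / m) ^ 2)).mul_left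
          (2 * (m : ℝ) * (π / m) ^ ((1 + 4 * k) / (2 * m) : ℝ))
        refine this.congr fun n => ?_
        ring
      refine Summable.of_norm_bounded_eventually hmaj ?_
      rw [Nat.cofinite_eq_atTop]
      filter_upwards [eventually_ge_atTop 2] with n hn
      rw [Real.norm_eq_abs, abs_norm]
      exact norm_rhoFactor_residue_le hm k hn
    have hPq : ∀ n : ℕ, P n = -(((2 * k + 2 * m * n : ℝ)) : ℂ) := by
      intro n; simp only [hP]; push_cast; ring
    have hq : ∀ n : ℕ, (0 : ℝ) ≤ 2 * k + 2 * m * n := fun n => by positivity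
    have hx : ∀ n : ℕ, ‖(2 * P n + 1) / (2 * P n - 3)‖ < 1 := by
      intro n
      rw [hPq]
      refine ((gf_pole_geometry (hq n)).1).trans_lt ?_
      have : 0 < 2 / (2 * (2 * (k : ℝ) + 2 * m * n) + 3) := by positivity
      linarith
    have hs : Summable fun n : ℕ =>
        ‖-8 * E n / (2 * P n - 3) ^ 2‖ * (1 - ‖(2 * P n + 1) / (2 * P n - 3)‖)⁻¹ := by
      refine Summable.of_nonneg_of_le (fun n => ?_) (fun n => ?_) (hEs.mul_left (4 / 3))
      · exact mul_nonneg (norm_nonneg _) (inv_nonneg.mpr (by linarith [hx n]))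
      · obtain ⟨hxle, h3⟩ := gf_pole_geometry (hq n)
        rw [← hPq] at hxle h3
        have hpos : (0 : ℝ) < 2 * (2 * k + 2 * m * n) + 3 := by positivity
        have hcn : ‖-8 * E n / (2 * P n - 3) ^ 2‖ = 8 * ‖E n‖ / (2 * (2 * k + 2 * m * n) + 3) ^ 2 := by
          rw [norm_div, norm_mul, norm_neg, norm_pow, h3]
          norm_num
        have hinv : (1 - ‖(2 * P n + 1) / (2 * P n - 3)‖)⁻¹ ≤ (2 * (2 * k + 2 * m * n) + 3) / 2 := by
          rw [show (2 * (2 * (k : ℝ) + 2 * m * n) + 3) / 2 = (2 / (2 * (2 * (k : ℝ) + 2 * m * n) + 3))⁻¹ by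
            rw [inv_div]]
          exact inv_anti₀ (by positivity) (by linarith)
        calc ‖-8 * E n / (2 * P n - 3) ^ 2‖ * (1 - ‖(2 * P n + 1) / (2 * P n - 3)‖)⁻¹
            ≤ 8 * ‖E n‖ / (2 * (2 * k + 2 * m * n) + 3) ^ 2 * ((2 * (2 * k + 2 * m * n) + 3) / 2) :=
              mul_le_mul hcn.le hinv (inv_nonneg.mpr (by linarith [hx n])) (by positivity)
          _ = 4 * ‖E n‖ / (2 * (2 * k + 2 * m * n) + 3) := by
              field_simp
              ring
          _ ≤ 4 / 3 * ‖E n‖ := by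
              rw [div_le_iff₀ hpos]
              nlinarith [mul_nonneg (hq n) (norm_nonneg (E n))]
    have hcoef : ∀ ℓ : ℕ, HasSum (fun n : ℕ => (-8 * E n / (2 * P n - 3) ^ 2) *
        ((2 * P n + 1) / (2 * P n - 3)) ^ ℓ)
        (fourierCoeff (T := 1) ((toLpOrZero ∞ haarAddCircle (circleRestrict 1 (rhoFactor m k ∘ cayley)) :
          Lp ℂ ∞ (haarAddCircle (T := 1))) : AddCircle (1:ℝ) → ℂ) (-(ℓ + 1 : ℤ))) := by
      intro ℓ
      have h := hasSum_fourierCoeff_rhoFactor hm hk E hpole hEs ℓ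
      have e : (-((ℓ + 1 : ℕ) : ℤ)) = -(ℓ + 1 : ℤ) := by push_cast; ring
      rw [e] at h
      rw [gf_fourierCoeff_congr_ae hae]
      exact h
    exact isCompactOperator_hardyOffDiag_of_hasSum_fourierCoeff _
      (x := fun n => (2 * P n + 1) / (2 * P n - 3)) (c := fun n => -8 * E n / (2 * P n - 3) ^ 2) hx hs hcoef

end LemmaFourSeven

end QuasiInner

end Literature.NumberTheory.ConnesConsani2021
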